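import Literature.Topology.FourManifolds.GluckTwistTubularUniqueness
import Literature.Topology.FourManifolds.KirbyMovesIsotopyProofs
import Literature.Topology.FourManifolds.KnotGroupTubular
import Mathlib.Geometry.Manifold.ContMDiffMFDeriv
import Mathlib.Geometry.Manifold.MFDeriv.Atlas
import Mathlib.Analysis.InnerProductSpace.Calculus
import Mathlib.Analysis.Normed.Module.Normalize
import HarnessLib

/-!
# Uniqueness of tubular neighbourhoods of a link in `S³`, up to rotation of the fibres

Topic `Literature/Topology/FourManifolds`; first step (S1) of the proof of the named fact
`Literature.Topology.FourManifolds.FramedLink.IsSurgery.nonempty_diffeomorph` (`KirbyMovesSurgery.lean`: uniqueness of Dehn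
surgery on a framed link, leaf (U) of the decomposition of Kirby's theorem recorded there).
Everything in this file is proved.

**Theorem** (`Literature.Topology.FourManifolds.Link.exists_diffeomorph_tubularNbhd`). Let `L` be a link in `S³` with finitely
many components and let `ν`, `ν'` be two families of *oriented* tubular neighbourhoods
`νᵢ, ν'ᵢ : S¹ × ℝ² ↪ S³` of its components (`Literature.Topology.FourManifolds.Knot.TubularNbhd`, with the orientation
convention `det_pos`), each family with pairwise disjoint images. Then there are a diffeomorphism
`φ` of `S³` fixing every component of `L` pointwise, a radius `r > 0` and smooth maps
`uᵢ : S¹ → S¹` with `φ (νᵢ (x, w)) = ν'ᵢ (x, uᵢ x · w)` for `‖w‖ < r` (complex multiplication of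
the fibre coordinate `w ∈ ℝ² = ℂ` by the unit vector `uᵢ x`, i.e. a rotation of the fibre).

This is the uniqueness of tubular neighbourhoods (Hirsch, *Differential Topology* (1976), Ch. 4
§5, Thm. 5.3: any two tubular neighbourhoods of a compact boundaryless submanifold are isotopic;
Kosinski, *Differential Manifolds* (1993), Ch. III, Thm. (3.5)) combined with the isotopy
extension theorem (Hirsch, Ch. 8 §1, Thm. 1.3), in the form of the tree's 2-knot version
`Literature.Topology.FourManifolds.TwoKnot.TubularNbhd.exists_diffeomorph_tubeFrame` (`GluckTwistTubularUniqueness.lean`), whose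
proof is repeated for the base `S¹` and the ambient `S³`, all components of the link being
treated at once in one stereographic chart, with one addition: **the orientations agree**. For
oriented `νᵢ`, `ν'ᵢ` the fibre derivative `A(x) = ∂_w(pr₂ ∘ ν'ᵢ⁻¹ ∘ νᵢ)(x, 0)` has positive
determinant (`det_knotFibreDeriv_pos`: in the angle coordinate the Jacobian frame of `νᵢ` along
the knot is that of `ν'ᵢ` times the block triangular differential of the transition map, so the
two `det_pos` determinants differ by the factor `det A(x)`), hence the orthogonal factor `Q(x)` of
`A(x)` is a rotation, `Q(x) w = uᵢ x · w`, and no reflection of the fibre occurs.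

## The proof (Kosinski III.(3.5); as in `GluckTwistTubularUniqueness.lean`)

1. *Transition map.* `τ = ν'⁻¹ ∘ ν` (`Literature.Topology.FourManifolds.knotTransition`) is smooth near the zero section, fixes it
   pointwise, `Dτ(x,0)(ξ, v) = (ξ + β v, A(x) v)` with the fibre derivative `A(x)`
   (`Literature.Topology.FourManifolds.knotFibreDeriv`), invertible and smooth in `x`.
2. *Orthogonal frame.* `Q(x) = [u(x), J u(x)]`, `u = A e₀/‖A e₀‖` (`Literature.Topology.FourManifolds.knotFrame`; the sign in
   front of `J u` is `+1` by `det A > 0`, `knotFrameSign_pos`); `(1 - t) A + t Q` is invertible.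
3. *Straight-line isotopy* in a stereographic chart `ℝ³ = S³ ∖ {pt}`, `pt ∉ ⋃ᵢ range ν'ᵢ`
   (`Link.exists_not_mem_iUnion_range`): `P = ν'ᵢ ∘ (id × Qᵢ) ∘ νᵢ⁻¹` near the `i`-th component,
   with `D((1-t) id + t P)` injective along the link.
4. *Isotopy extension* (`Literature.Topology.FourManifolds.exists_diffeomorph_eqOn_nhdsSet_of_straightLine`) and transport back to
   `S³` (`Literature.Topology.FourManifolds.exists_diffeomorph_chartTransport`).

## References

* M. W. Hirsch, *Differential Topology*, GTM 33, Springer (1976), Ch. 4 §5, Thm. 5.3; Ch. 8 §1,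
  Thm. 1.3. [cite: Hirsch1976, Ch. 4 §5 Thm. 5.3]
* A. Kosinski, *Differential Manifolds*, Academic Press (1993), Ch. III, Thms. (3.1), (3.5).
  [cite: Kosinski1993, Ch. III Thm (3.5)]
* D. Rolfsen, *Knots and Links* (1976), §9.F (the surgered manifold depends only on the framed
  link). [cite: Rolfsen1976, §9.F]

## Design notes

* The plane algebra (`planeE0`, `planeE1`, `frameMap`, `frameIsometry`, `injective_lineToFrame`,
  `inner_frame_ne_zero`, `quarterTurn`) is the tree's (`GluckTwistTubularUniqueness.lean`,
  `GluckTwistFibre.lean`); the angle-coordinate frame determinant (`Knot.TubularNbhd.paramCoe`,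
  `tubeFrameDet_paramCoe_pos`, `frameDet_expand`) is from `KirbyMovesIsotopyProofs.lean` /
  `DehnSurgeryTubularNbhdProofs.lean`; the local angle function near `circlePoint 0` is built from
  `Literature.Topology.FourManifolds.angB` (`TorusCoordinates.lean`).
* Names carry the prefix `knot`/`circle` to stay clear of the 2-knot declarations
  (`Literature.Topology.FourManifolds.tubeTransition`, `Literature.Topology.FourManifolds.fibreDeriv`, …) and of `Literature.Topology.FourManifolds.Knot.TubularNbhd.fibreDeriv`
  (`LinkingNumberWellDefined.lean`).
* No declaration in this file uses `sorry`.
-/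

noncomputable section

open Set Function Metric Filter
open scoped Manifold ContDiff Topology RealInnerProductSpace

namespace Literature.Topology.FourManifolds

/-- Local notation: `𝔼 n` is the model Euclidean space `EuclideanSpace ℝ (Fin n)`. -/
local notation "𝔼 " n:arg => EuclideanSpace ℝ (Fin n)

/-- Local notation: `𝕊 n` is the unit sphere in `EuclideanSpace ℝ (Fin (n + 1))`. -/
local notation "𝕊 " n:arg => (Metric.sphere (0 : EuclideanSpace ℝ (Fin (n + 1))) 1)

/-- Local notation: the model with corners of the tube `S¹ × ℝ²`. -/
local notation "I𝕋₁" => (ModelWithCorners.prod (𝓡 1) 𝓘(ℝ, EuclideanSpace ℝ (Fin 2)))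

attribute [local instance] fact_finrank_euclideanSpace_two fact_finrank_euclideanSpace_four

/-! ### Tubular neighbourhood maps of knots as partial diffeomorphisms -/

namespace Knot.TubularNbhd

variable {K : 𝕊 1 → 𝕊 3} (ν : Knot.TubularNbhd K)

/-- A tubular neighbourhood map `ν : S¹ × ℝ² → S³` is an open embedding. [folklore] -/
protected theorem isOpenEmbedding : Topology.IsOpenEmbedding ν :=
  ⟨ν.isSmoothEmbedding_coe.isEmbedding, ν.isOpenMap.isOpen_range⟩

/-- The tubular neighbourhood as an open partial homeomorphism `S¹ × ℝ² ⇀ S³` (source `univ`,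
target `range ν`). [folklore] -/
def toHomeo : OpenPartialHomeomorph ((𝕊 1) × 𝔼 2) (𝕊 3) :=
  haveI : Nonempty ((𝕊 1) × 𝔼 2) := ⟨(circlePoint 0, 0)⟩
  ν.isOpenEmbedding.toOpenPartialHomeomorph _

/-- The partial homeomorphism of `ν` is `ν` as a function. [folklore] -/
@[simp] theorem toHomeo_apply (q : (𝕊 1) × 𝔼 2) : ν.toHomeo q = ν q := rfl

/-- The partial homeomorphism of `ν` is defined everywhere. [folklore] -/
@[simp] theorem toHomeo_source : ν.toHomeo.source = univ := by simp [toHomeo]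

/-- The target of the partial homeomorphism of `ν` is the range of `ν`. [folklore] -/
@[simp] theorem toHomeo_target : ν.toHomeo.target = range ν := by simp [toHomeo]

/-- The inverse partial homeomorphism is a left inverse of `ν`. [folklore] -/
@[simp] theorem toHomeo_symm_apply (q : (𝕊 1) × 𝔼 2) : ν.toHomeo.symm (ν q) = q :=
  haveI : Nonempty ((𝕊 1) × 𝔼 2) := ⟨(circlePoint 0, 0)⟩
  ν.isOpenEmbedding.toOpenPartialHomeomorph_left_inv

/-- `ν ∘ ν⁻¹ = id` on the range. [folklore] -/
theorem apply_toHomeo_symm {p : 𝕊 3} (hp : p ∈ range ν) : ν (ν.toHomeo.symm p) = p := by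
  have h := ν.toHomeo.right_inv (show p ∈ ν.toHomeo.target by rwa [ν.toHomeo_target])
  simpa using h

/-- **The inverse of a tubular neighbourhood map is smooth on its range** (inverse function
theorem for the open smooth embedding `ν`, `Literature.Topology.FourManifolds.contMDiffOn_symm_of_isSmoothEmbedding`).
[folklore] -/
theorem contMDiffOn_toHomeo_symm : ContMDiffOn (𝓡 3) I𝕋₁ ∞ ν.toHomeo.symm (range ν) :=
  haveI : Nonempty ((𝕊 1) × 𝔼 2) := ⟨(circlePoint 0, 0)⟩
  contMDiffOn_symm_of_isSmoothEmbedding ν.isSmoothEmbedding_coe ν.isOpenEmbedding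

/-- `ν` is `C^∞` at every point. [folklore] -/
theorem contMDiffAt_coe (q : (𝕊 1) × 𝔼 2) : ContMDiffAt I𝕋₁ (𝓡 3) ∞ ν q :=
  ν.contMDiff.contMDiffAt

/-- The inverse of `ν` is `C^∞` at the points of the range. [folklore] -/
theorem contMDiffAt_toHomeo_symm {p : 𝕊 3} (hp : p ∈ range ν) :
    ContMDiffAt (𝓡 3) I𝕋₁ ∞ ν.toHomeo.symm p :=
  ν.contMDiffOn_toHomeo_symm.contMDiffAt (ν.isOpenMap.isOpen_range.mem_nhds hp)

/-- `ν ∘ ν⁻¹ = id` near every point of the (open) range. [folklore] -/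
theorem coe_toHomeo_symm_eventuallyEq {p : 𝕊 3} (hp : p ∈ range ν) :
    (ν ∘ ν.toHomeo.symm) =ᶠ[𝓝 p] id := by
  filter_upwards [ν.isOpenMap.isOpen_range.mem_nhds hp] with p' hp'
  exact ν.apply_toHomeo_symm hp'

/-- **The differential of a tubular neighbourhood map is injective** (it has the smooth left
inverse `ν⁻¹` on the open range). [folklore] -/
theorem injective_mfderiv_coe (q : (𝕊 1) × 𝔼 2) : Injective (mfderiv I𝕋₁ (𝓡 3) ν q) := by
  have h1 : HasMFDerivAt I𝕋₁ (𝓡 3) ν q (mfderiv I𝕋₁ (𝓡 3) ν q) :=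
    ((ν.contMDiffAt_coe q).mdifferentiableAt (by simp)).hasMFDerivAt
  have h2 : HasMFDerivAt (𝓡 3) I𝕋₁ ν.toHomeo.symm (ν q)
      (mfderiv (𝓡 3) I𝕋₁ ν.toHomeo.symm (ν q)) :=
    ((ν.contMDiffAt_toHomeo_symm ⟨q, rfl⟩).mdifferentiableAt (by simp)).hasMFDerivAt
  have hc := h2.comp q h1
  have hid : (ν.toHomeo.symm ∘ ν) = id := funext fun q' => ν.toHomeo_symm_apply q'
  rw [hid] at hc
  have heq := (hasMFDerivAt_id (I := I𝕋₁) q).mfderiv ▸ hc.mfderiv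
  have key : ∀ w, mfderiv (𝓡 3) I𝕋₁ ν.toHomeo.symm (ν q) (mfderiv I𝕋₁ (𝓡 3) ν q w) = w :=
    fun w => ((ContinuousLinearMap.ext_iff.1 heq) w).symm
  exact Function.LeftInverse.injective key

/-- **The differential of `ν⁻¹` is injective at the points of the range**. [folklore] -/
theorem injective_mfderiv_toHomeo_symm {p : 𝕊 3} (hp : p ∈ range ν) :
    Injective (mfderiv (𝓡 3) I𝕋₁ ν.toHomeo.symm p) := by
  have h2 : HasMFDerivAt (𝓡 3) I𝕋₁ ν.toHomeo.symm p (mfderiv (𝓡 3) I𝕋₁ ν.toHomeo.symm p) :=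
    ((ν.contMDiffAt_toHomeo_symm hp).mdifferentiableAt (by simp)).hasMFDerivAt
  have h1 : HasMFDerivAt I𝕋₁ (𝓡 3) ν (ν.toHomeo.symm p)
      (mfderiv I𝕋₁ (𝓡 3) ν (ν.toHomeo.symm p)) :=
    ((ν.contMDiffAt_coe _).mdifferentiableAt (by simp)).hasMFDerivAt
  have hc := (h1.comp p h2).congr_of_eventuallyEq (ν.coe_toHomeo_symm_eventuallyEq hp).symm
  have heq := (hasMFDerivAt_id (I := 𝓡 3) p).mfderiv ▸ hc.mfderiv
  have key : ∀ w, mfderiv I𝕋₁ (𝓡 3) ν (ν.toHomeo.symm p)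
      (mfderiv (𝓡 3) I𝕋₁ ν.toHomeo.symm p w) = w :=
    fun w => ((ContinuousLinearMap.ext_iff.1 heq) w).symm
  exact Function.LeftInverse.injective key

end Knot.TubularNbhd

/-! ### The transition map of two tubular neighbourhoods of a knot -/

section Transition

variable {K : 𝕊 1 → 𝕊 3} (ν₁ ν₂ : Knot.TubularNbhd K)

/-- The **transition map** `τ = ν₂⁻¹ ∘ ν₁` of two tubular neighbourhoods of the same knot
(defined everywhere, meaningful on `ν₁⁻¹(range ν₂)`); Kosinski (1993), III §3. [folklore] -/
def knotTransition : (𝕊 1) × 𝔼 2 → (𝕊 1) × 𝔼 2 := ν₂.toHomeo.symm ∘ ν₁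

/-- The domain `ν₁⁻¹(range ν₂)` of the transition map. [folklore] -/
def knotTransitionDom : Set ((𝕊 1) × 𝔼 2) := ν₁ ⁻¹' range ν₂

/-- The domain of the transition map is open. [folklore] -/
theorem isOpen_knotTransitionDom : IsOpen (knotTransitionDom ν₁ ν₂) :=
  ν₂.isOpenMap.isOpen_range.preimage ν₁.continuous

/-- The zero section lies in the domain of the transition map. [folklore] -/
theorem mem_knotTransitionDom_zero (x : 𝕊 1) :
    ((x, (0 : 𝔼 2)) : (𝕊 1) × 𝔼 2) ∈ knotTransitionDom ν₁ ν₂ := by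
  show ν₁ (x, 0) ∈ range ν₂
  rw [ν₁.coe_apply_zero, ← ν₂.coe_apply_zero]
  exact ⟨_, rfl⟩

/-- The transition map fixes the zero section pointwise. [folklore] -/
@[simp]
theorem knotTransition_zero (x : 𝕊 1) : knotTransition ν₁ ν₂ (x, 0) = (x, 0) := by
  simp only [knotTransition, comp_apply, ν₁.coe_apply_zero]
  rw [← ν₂.coe_apply_zero x, ν₂.toHomeo_symm_apply]

/-- `ν₂ ∘ τ = ν₁` on the domain. [folklore] -/
theorem apply_knotTransition {q : (𝕊 1) × 𝔼 2} (hq : q ∈ knotTransitionDom ν₁ ν₂) :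
    ν₂ (knotTransition ν₁ ν₂ q) = ν₁ q :=
  ν₂.apply_toHomeo_symm hq

/-- The transition map is `C^∞` on its domain. [folklore] -/
theorem contMDiffAt_knotTransition {q : (𝕊 1) × 𝔼 2} (hq : q ∈ knotTransitionDom ν₁ ν₂) :
    ContMDiffAt I𝕋₁ I𝕋₁ ∞ (knotTransition ν₁ ν₂) q :=
  (ν₂.contMDiffAt_toHomeo_symm hq).comp q (ν₁.contMDiffAt_coe q)

/-- The transition map is differentiable at the points of the zero section. [folklore] -/
theorem mdifferentiableAt_knotTransition (x : 𝕊 1) :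
    MDifferentiableAt I𝕋₁ I𝕋₁ (knotTransition ν₁ ν₂) (x, 0) :=
  (contMDiffAt_knotTransition ν₁ ν₂ (mem_knotTransitionDom_zero ν₁ ν₂ x)).mdifferentiableAt
    (by simp)

/-- **The differential of the transition map is injective** at the zero section. [folklore] -/
theorem injective_mfderiv_knotTransition (x : 𝕊 1) :
    Injective (mfderiv I𝕋₁ I𝕋₁ (knotTransition ν₁ ν₂) (x, 0)) := by
  have h1 := ((ν₁.contMDiffAt_coe (x, 0)).mdifferentiableAt (by simp)).hasMFDerivAt
  have h2 := ((ν₂.contMDiffAt_toHomeo_symm (mem_knotTransitionDom_zero ν₁ ν₂ x)).mdifferentiableAt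
    (by simp)).hasMFDerivAt
  have hc := h2.comp ((x, (0 : 𝔼 2)) : (𝕊 1) × 𝔼 2) h1
  rw [show ν₂.toHomeo.symm ∘ ν₁ = knotTransition ν₁ ν₂ from rfl] at hc
  rw [hc.mfderiv]
  intro u v huv
  exact ν₁.injective_mfderiv_coe _
    (ν₂.injective_mfderiv_toHomeo_symm (mem_knotTransitionDom_zero ν₁ ν₂ x) huv)

/-- The **fibre derivative** `A(x) = ∂_w (pr₂ ∘ τ)(x, 0)` of the transition map along the zero
section (Kosinski (1993), III.(3.1): the vector bundle map underlying `ν₂⁻¹ ∘ ν₁`). [folklore] -/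
def knotFibreDeriv (x : 𝕊 1) : 𝔼 2 →L[ℝ] 𝔼 2 :=
  fderiv ℝ (fun w : 𝔼 2 => (knotTransition ν₁ ν₂ (x, w)).2) 0

/-- The fibre partial map `w ↦ τ (x, w)` is differentiable at `0`. [folklore] -/
theorem mdifferentiableAt_knotTransition_fibre (x : 𝕊 1) :
    MDifferentiableAt 𝓘(ℝ, 𝔼 2) I𝕋₁ (fun w : 𝔼 2 => knotTransition ν₁ ν₂ (x, w)) 0 := by
  have h : ContMDiffAt 𝓘(ℝ, 𝔼 2) I𝕋₁ ∞ (fun w : 𝔼 2 => knotTransition ν₁ ν₂ (x, w)) 0 :=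
    (contMDiffAt_knotTransition ν₁ ν₂ (mem_knotTransitionDom_zero ν₁ ν₂ x)).comp 0
      (contMDiffAt_const.prodMk contMDiffAt_id)
  exact h.mdifferentiableAt (by simp)

/-- **Block structure of the differential of the transition map at the zero section**:
`Dτ(x, 0) (ξ, v) = (ξ + β v, A(x) v)` — the second component is the fibre derivative.
[folklore] -/
theorem mfderiv_knotTransition_snd (x : 𝕊 1) (u : TangentSpace I𝕋₁ ((x, (0 : 𝔼 2)) : (𝕊 1) × 𝔼 2)) :
    (mfderiv I𝕋₁ I𝕋₁ (knotTransition ν₁ ν₂) (x, 0) u).2 = knotFibreDeriv ν₁ ν₂ x u.2 := by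
  have hτ := mdifferentiableAt_knotTransition ν₁ ν₂ x
  have hc := mfderiv_comp ((x, (0 : 𝔼 2)) : (𝕊 1) × 𝔼 2)
    (mdifferentiableAt_snd (I := 𝓡 1) (I' := 𝓘(ℝ, 𝔼 2))) hτ
  rw [mfderiv_snd] at hc
  have h1 : (mfderiv I𝕋₁ I𝕋₁ (knotTransition ν₁ ν₂) (x, 0) u).2 =
      mfderiv I𝕋₁ 𝓘(ℝ, 𝔼 2) (Prod.snd ∘ knotTransition ν₁ ν₂) (x, 0) u := by
    rw [hc]; rfl
  have hg : MDifferentiableAt I𝕋₁ 𝓘(ℝ, 𝔼 2) (Prod.snd ∘ knotTransition ν₁ ν₂) (x, 0) :=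
    (mdifferentiableAt_snd (I := 𝓡 1) (I' := 𝓘(ℝ, 𝔼 2))).comp _ hτ
  have hdec := mfderiv_prod_eq_add_apply (v := u) hg
  have h2 : (fun z : 𝕊 1 =>
      (Prod.snd ∘ knotTransition ν₁ ν₂) (z, ((x, (0 : 𝔼 2)) : (𝕊 1) × 𝔼 2).2)) =
      fun _ => (0 : 𝔼 2) := by
    funext z
    simp [knotTransition_zero]
  rw [h2, mfderiv_const] at hdec
  rw [h1, hdec]
  have h0 : ∀ w : TangentSpace (𝓡 1) x,
      (0 : TangentSpace (𝓡 1) ((x, (0 : 𝔼 2)) : (𝕊 1) × 𝔼 2).1 →L[ℝ]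
        TangentSpace 𝓘(ℝ, 𝔼 2) ((Prod.snd ∘ knotTransition ν₁ ν₂)
          (((x, (0 : 𝔼 2)) : (𝕊 1) × 𝔼 2).1, ((x, (0 : 𝔼 2)) : (𝕊 1) × 𝔼 2).2))) w = 0 :=
    fun w => rfl
  erw [h0, zero_add, mfderiv_eq_fderiv]
  rfl

/-- **Block structure of the differential of the transition map at the zero section**:
`Dτ(x, 0) (ξ, 0) = (ξ, 0)` (the zero section is fixed pointwise). [folklore] -/
theorem mfderiv_knotTransition_horizontal (x : 𝕊 1) (ξ : TangentSpace (𝓡 1) x) :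
    mfderiv I𝕋₁ I𝕋₁ (knotTransition ν₁ ν₂) (x, 0)
      ((ξ, 0) : TangentSpace I𝕋₁ ((x, (0 : 𝔼 2)) : (𝕊 1) × 𝔼 2)) = (ξ, 0) := by
  have h := mfderiv_prod_eq_add_apply (I := 𝓡 1) (I' := 𝓘(ℝ, 𝔼 2)) (I'' := I𝕋₁)
    (f := knotTransition ν₁ ν₂) (p := ((x, (0 : 𝔼 2)) : (𝕊 1) × 𝔼 2))
    (v := ((ξ, 0) : TangentSpace I𝕋₁ ((x, (0 : 𝔼 2)) : (𝕊 1) × 𝔼 2)))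
    (mdifferentiableAt_knotTransition ν₁ ν₂ x)
  have h2 : (fun z : 𝕊 1 => knotTransition ν₁ ν₂ (z, ((x, (0 : 𝔼 2)) : (𝕊 1) × 𝔼 2).2)) =
      fun z => (z, (0 : 𝔼 2)) := by
    funext z; exact knotTransition_zero ν₁ ν₂ z
  rw [h2, mfderiv_prod_left] at h
  rw [h]
  erw [map_zero, add_zero]
  rfl

/-- **The fibre derivative is invertible** (injective): `Dτ(x, 0)` is injective and block
triangular. [folklore] -/
theorem injective_knotFibreDeriv (x : 𝕊 1) : Injective (knotFibreDeriv ν₁ ν₂ x) := by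
  rw [injective_iff_map_eq_zero]
  intro v hv
  set T := mfderiv I𝕋₁ I𝕋₁ (knotTransition ν₁ ν₂) (x, 0) with hT
  set u : TangentSpace I𝕋₁ ((x, (0 : 𝔼 2)) : (𝕊 1) × 𝔼 2) := (0, v) with hu
  have h2 : (T u).2 = 0 := by rw [hT, mfderiv_knotTransition_snd, hu, hv]
  have h1 : T u = T (((T u).1, 0) : TangentSpace I𝕋₁ ((x, (0 : 𝔼 2)) : (𝕊 1) × 𝔼 2)) := by
    rw [hT, mfderiv_knotTransition_horizontal]
    exact Prod.ext rfl h2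
  have h3 := injective_mfderiv_knotTransition ν₁ ν₂ x h1
  have := congrArg Prod.snd h3
  simpa [hu] using this

/-- **Smoothness of the fibre derivative along the knot** (the derivative in the vector-space
variable of a jointly smooth map depends smoothly on the manifold parameter; Mathlib's
`ContMDiffAt.mfderiv`). [folklore] -/
theorem contMDiff_knotFibreDeriv : ContMDiff (𝓡 1) 𝓘(ℝ, 𝔼 2 →L[ℝ] 𝔼 2) ∞ (knotFibreDeriv ν₁ ν₂) := by
  intro x₀
  have hf : ContMDiffAt ((𝓡 1).prod 𝓘(ℝ, 𝔼 2)) 𝓘(ℝ, 𝔼 2) ∞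
      (uncurry fun (x : 𝕊 1) (w : 𝔼 2) => (knotTransition ν₁ ν₂ (x, w)).2)
      (x₀, (fun _ => (0 : 𝔼 2)) x₀) := by
    have : (uncurry fun (x : 𝕊 1) (w : 𝔼 2) => (knotTransition ν₁ ν₂ (x, w)).2) =
        Prod.snd ∘ knotTransition ν₁ ν₂ := by
      funext q; rfl
    rw [this]
    exact contMDiffAt_snd.comp _
      (contMDiffAt_knotTransition ν₁ ν₂ (mem_knotTransitionDom_zero ν₁ ν₂ x₀))
  have h := ContMDiffAt.mfderiv (I := 𝓘(ℝ, 𝔼 2)) (I' := 𝓘(ℝ, 𝔼 2)) (J := 𝓡 1) (m := ∞)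
    (fun (x : 𝕊 1) (w : 𝔼 2) => (knotTransition ν₁ ν₂ (x, w)).2) (fun _ => (0 : 𝔼 2)) hf
    contMDiffAt_const (by simp)
  rw [inTangentCoordinates_model_space] at h
  refine h.congr_of_eventuallyEq (Filter.Eventually.of_forall fun x => ?_)
  show knotFibreDeriv ν₁ ν₂ x =
    mfderiv 𝓘(ℝ, 𝔼 2) 𝓘(ℝ, 𝔼 2) (fun w : 𝔼 2 => (knotTransition ν₁ ν₂ (x, w)).2) 0
  rw [mfderiv_eq_fderiv]
  rfl

end Transition

/-! ### Fibrewise linear maps of the tube `S¹ × ℝ²` -/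

section Fibrewise

variable (g : (𝕊 1) → (𝔼 2 ≃ₗᵢ[ℝ] 𝔼 2))

/-- The **fibrewise map** `(x, w) ↦ (x, g(x) w)` of the tube `S¹ × ℝ²` attached to a family `g`
of linear isometries of the fibre. [folklore] -/
def circleFibrewiseMap (q : (𝕊 1) × 𝔼 2) : (𝕊 1) × 𝔼 2 := (q.1, g q.1 q.2)

/-- The fibrewise map, unfolded. [folklore] -/
@[simp]
theorem circleFibrewiseMap_apply (q : (𝕊 1) × 𝔼 2) : circleFibrewiseMap g q = (q.1, g q.1 q.2) :=
  rfl

/-- The fibrewise map fixes the zero section. [folklore] -/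
theorem circleFibrewiseMap_zero (x : 𝕊 1) : circleFibrewiseMap g (x, 0) = (x, 0) := by simp

variable {g}

/-- The fibrewise map of a smooth family is smooth. [folklore] -/
theorem contMDiff_circleFibrewiseMap
    (hg : ContMDiff I𝕋₁ 𝓘(ℝ, 𝔼 2) ∞ fun p : (𝕊 1) × 𝔼 2 => g p.1 p.2) :
    ContMDiff I𝕋₁ I𝕋₁ ∞ (circleFibrewiseMap g) :=
  contMDiff_fst.prodMk hg

/-- The fibrewise map is differentiable. [folklore] -/
theorem mdifferentiableAt_circleFibrewiseMap
    (hg : ContMDiff I𝕋₁ 𝓘(ℝ, 𝔼 2) ∞ fun p : (𝕊 1) × 𝔼 2 => g p.1 p.2) (q : (𝕊 1) × 𝔼 2) :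
    MDifferentiableAt I𝕋₁ I𝕋₁ (circleFibrewiseMap g) q :=
  ((contMDiff_circleFibrewiseMap hg) q).mdifferentiableAt (by simp)

/-- **Differential of a fibrewise map at the zero section**, vertical part:
`D(x, 0) (ξ, v) = (ξ, g(x) v)`, second component. [folklore] -/
theorem mfderiv_circleFibrewiseMap_snd
    (hg : ContMDiff I𝕋₁ 𝓘(ℝ, 𝔼 2) ∞ fun p : (𝕊 1) × 𝔼 2 => g p.1 p.2) (x : 𝕊 1)
    (u : TangentSpace I𝕋₁ ((x, (0 : 𝔼 2)) : (𝕊 1) × 𝔼 2)) :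
    (mfderiv I𝕋₁ I𝕋₁ (circleFibrewiseMap g) (x, 0) u).2 = g x u.2 := by
  have hF := mdifferentiableAt_circleFibrewiseMap hg ((x, (0 : 𝔼 2)) : (𝕊 1) × 𝔼 2)
  have hc := mfderiv_comp ((x, (0 : 𝔼 2)) : (𝕊 1) × 𝔼 2)
    (mdifferentiableAt_snd (I := 𝓡 1) (I' := 𝓘(ℝ, 𝔼 2))) hF
  rw [mfderiv_snd] at hc
  have h1 : (mfderiv I𝕋₁ I𝕋₁ (circleFibrewiseMap g) (x, 0) u).2 =
      mfderiv I𝕋₁ 𝓘(ℝ, 𝔼 2) (Prod.snd ∘ circleFibrewiseMap g) (x, 0) u := by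
    rw [hc]; rfl
  have hG : MDifferentiableAt I𝕋₁ 𝓘(ℝ, 𝔼 2) (Prod.snd ∘ circleFibrewiseMap g) (x, 0) :=
    (mdifferentiableAt_snd (I := 𝓡 1) (I' := 𝓘(ℝ, 𝔼 2))).comp _ hF
  have hdec := mfderiv_prod_eq_add_apply (v := u) hG
  have h2 : (fun z : 𝕊 1 =>
      (Prod.snd ∘ circleFibrewiseMap g) (z, ((x, (0 : 𝔼 2)) : (𝕊 1) × 𝔼 2).2)) =
      fun _ => (0 : 𝔼 2) := by
    funext z
    simp
  rw [h2, mfderiv_const] at hdec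
  rw [h1, hdec]
  have h0 : ∀ w : TangentSpace (𝓡 1) x,
      (0 : TangentSpace (𝓡 1) ((x, (0 : 𝔼 2)) : (𝕊 1) × 𝔼 2).1 →L[ℝ]
        TangentSpace 𝓘(ℝ, 𝔼 2) ((Prod.snd ∘ circleFibrewiseMap g)
          (((x, (0 : 𝔼 2)) : (𝕊 1) × 𝔼 2).1, ((x, (0 : 𝔼 2)) : (𝕊 1) × 𝔼 2).2))) w = 0 :=
    fun w => rfl
  have h3 : (fun z : 𝔼 2 => (Prod.snd ∘ circleFibrewiseMap g) (x, z)) =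
      (g x).toContinuousLinearEquiv := by
    funext z; simp
  erw [h0, zero_add, mfderiv_eq_fderiv, h3, (g x).toContinuousLinearEquiv.fderiv]
  rfl

/-- **Differential of a fibrewise map at the zero section**, horizontal part:
`D(x, 0) (ξ, 0) = (ξ, 0)`. [folklore] -/
theorem mfderiv_circleFibrewiseMap_horizontal
    (hg : ContMDiff I𝕋₁ 𝓘(ℝ, 𝔼 2) ∞ fun p : (𝕊 1) × 𝔼 2 => g p.1 p.2) (x : 𝕊 1)
    (ξ : TangentSpace (𝓡 1) x) :
    mfderiv I𝕋₁ I𝕋₁ (circleFibrewiseMap g) (x, 0)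
      ((ξ, 0) : TangentSpace I𝕋₁ ((x, (0 : 𝔼 2)) : (𝕊 1) × 𝔼 2)) = (ξ, 0) := by
  have h := mfderiv_prod_eq_add_apply (I := 𝓡 1) (I' := 𝓘(ℝ, 𝔼 2)) (I'' := I𝕋₁)
    (f := circleFibrewiseMap g) (p := ((x, (0 : 𝔼 2)) : (𝕊 1) × 𝔼 2))
    (v := ((ξ, 0) : TangentSpace I𝕋₁ ((x, (0 : 𝔼 2)) : (𝕊 1) × 𝔼 2)))
    (mdifferentiableAt_circleFibrewiseMap hg _)
  have h2 : (fun z : 𝕊 1 => circleFibrewiseMap g (z, ((x, (0 : 𝔼 2)) : (𝕊 1) × 𝔼 2).2)) =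
      fun z => (z, (0 : 𝔼 2)) := by
    funext z; simp
  rw [h2, mfderiv_prod_left] at h
  rw [h]
  erw [map_zero, add_zero]
  rfl

end Fibrewise


/-! ### The orientations agree: the fibre derivative has positive determinant -/

section Orientation

open Real

/-- A **local angle function** near `circlePoint 0`: `2π (angB u - 1)`, a smooth left inverse of
`circlePoint` on `(-π, π)` built from the tree's `Literature.Topology.FourManifolds.angB` (`TorusCoordinates.lean`). [folklore] -/
def locAng (u : 𝕊 1) : ℝ := 2 * π * (angB u - 1)

/-- `circlePoint ∘ locAng = id`. [folklore] -/
theorem circlePoint_locAng (u : 𝕊 1) : circlePoint (locAng u) = u := by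
  rw [locAng, mul_sub, mul_one, sub_eq_add_neg, ← neg_mul, show -(2 : ℝ) * π = -(2 * π) by ring]
  rw [show 2 * π * angB u + -(2 * π) = 2 * π * angB u - 2 * π by ring]
  have h := circlePoint_add_two_pi (2 * π * angB u - 2 * π)
  rw [sub_add_cancel] at h
  rw [← h, ← circlePt_eq_circlePoint, circlePt_angB]

/-- `locAng ∘ circlePoint = id` on `(-π, π)`. [folklore] -/
theorem locAng_circlePoint {θ : ℝ} (hθ : θ ∈ Ioo (-π) π) : locAng (circlePoint θ) = θ := by
  have h2π : 0 < 2 * π := by positivity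
  have hmem : θ / (2 * π) + 1 ∈ Ioo (1 / 2 : ℝ) (3 / 2) := by
    constructor
    · have : -(1 / 2 : ℝ) < θ / (2 * π) := by
        rw [lt_div_iff₀ h2π]; linarith [hθ.1]
      linarith
    · have : θ / (2 * π) < 1 / 2 := by
        rw [div_lt_iff₀ h2π]; linarith [hθ.2]
      linarith
  have hc : circlePoint θ = circlePt (θ / (2 * π) + 1) := by
    rw [circlePt_add_one, circlePt_eq_circlePoint, mul_div_cancel₀ _ h2π.ne']
  rw [hc, locAng, angB_circlePt hmem]
  field_simp
  ring

/-- `locAng (circlePoint 0) = 0`. [folklore] -/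
theorem locAng_circlePoint_zero : locAng (circlePoint 0) = 0 :=
  locAng_circlePoint ⟨by linarith [pi_pos], pi_pos⟩

/-- The local angle function is smooth away from `ptB = (-1, 0)`. [folklore] -/
theorem contMDiffAt_locAng {u : 𝕊 1} (hu : u ≠ ptB) : ContMDiffAt (𝓡 1) 𝓘(ℝ, ℝ) ∞ locAng u :=
  contMDiffAt_const.mul ((contMDiffAt_angB hu).sub contMDiffAt_const)

/-- `circlePoint 0 ≠ ptB`. [folklore] -/
theorem circlePoint_zero_ne_ptB : circlePoint 0 ≠ ptB := by
  intro h
  have h1 := congrArg (fun u : 𝕊 1 => (u : 𝔼 2) 0) h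
  simp only [circlePoint_apply_zero, Real.cos_zero] at h1
  have h2 : ((ptB : 𝕊 1) : 𝔼 2) 0 = -1 := by
    have := toC_ptB
    exact congrArg Complex.re this
  rw [h2] at h1
  norm_num at h1

/-- **Row operations in the frame determinant**: replacing the two fibre rows by
`βₖ • a + (A eₖ)₀ • b + (A eₖ)₁ • c` multiplies the determinant by `det A`. [folklore] -/
theorem frameDet_rows_comb (r₀ a b c : 𝔼 4) (β₀ β₁ x y z w : ℝ) :
    frameDet r₀ a (β₀ • a + x • b + y • c) (β₁ • a + z • b + w • c) =
      (x * w - y * z) * frameDet r₀ a b c := by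
  simp only [frameDet_expand, PiLp.add_apply, PiLp.smul_apply, smul_eq_mul]
  ring

/-- The quarter turn is homogeneous. [folklore] -/
theorem quarterTurn_smul' (c : ℝ) (v : 𝔼 2) : quarterTurn (c • v) = c • quarterTurn v := by
  ext i
  fin_cases i <;> simp [quarterTurn]

/-- `⟪A e₁, J (A e₀)⟫ = det A` in coordinates. [folklore] -/
theorem inner_quarterTurn_eq_det (a₀ a₁ : 𝔼 2) :
    ⟪a₁, quarterTurn a₀⟫ = a₀ 0 * a₁ 1 - a₀ 1 * a₁ 0 := by
  simp [quarterTurn, PiLp.inner_apply, Fin.sum_univ_two]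
  ring

variable {K : 𝕊 1 → 𝕊 3} (ν₁ ν₂ : Knot.TubularNbhd K)

/-- The transition map in the angle coordinate near `circlePoint 0`:
`(θ, w) ↦ (locAng (pr₁ τ (circlePoint θ, w)), pr₂ τ (circlePoint θ, w))`. [folklore] -/
def flatTransition (q : ℝ × 𝔼 2) : ℝ × 𝔼 2 :=
  (locAng (knotTransition ν₁ ν₂ (circlePoint q.1, q.2)).1,
    (knotTransition ν₁ ν₂ (circlePoint q.1, q.2)).2)

/-- The angle-coordinate lift `(θ, w) ↦ (circlePoint θ, w)` is smooth. [folklore] -/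
theorem contMDiff_circlePoint_prod :
    ContMDiff 𝓘(ℝ, ℝ × 𝔼 2) I𝕋₁ ∞ fun q : ℝ × 𝔼 2 => ((circlePoint q.1, q.2) : (𝕊 1) × 𝔼 2) := by
  have h1 : ContMDiff 𝓘(ℝ, ℝ × 𝔼 2) 𝓘(ℝ, ℝ) ∞ (fun q : ℝ × 𝔼 2 ↦ q.1) :=
    (ContinuousLinearMap.fst ℝ ℝ (𝔼 2)).contMDiff
  have h2 : ContMDiff 𝓘(ℝ, ℝ × 𝔼 2) 𝓘(ℝ, 𝔼 2) ∞ (fun q : ℝ × 𝔼 2 ↦ q.2) :=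
    (ContinuousLinearMap.snd ℝ ℝ (𝔼 2)).contMDiff
  exact (contMDiff_circlePoint.comp h1).prodMk h2

/-- `ν₂ ∘ flatTransition = ν₁` (in the angle coordinate, with values in `ℝ⁴`) wherever
`ν₁ (circlePoint θ, w) ∈ range ν₂`. [folklore] -/
theorem paramCoe_flatTransition {q : ℝ × 𝔼 2}
    (hq : ((circlePoint q.1, q.2) : (𝕊 1) × 𝔼 2) ∈ knotTransitionDom ν₁ ν₂) :
    ν₂.paramCoe (flatTransition ν₁ ν₂ q) = ν₁.paramCoe q := by
  simp only [Knot.TubularNbhd.paramCoe, Knot.TubularNbhd.param_apply, flatTransition,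
    circlePoint_locAng, Prod.mk.eta]
  rw [apply_knotTransition ν₁ ν₂ hq]

/-- The flat transition map fixes `(0, 0)`. [folklore] -/
theorem flatTransition_zero_zero : flatTransition ν₁ ν₂ (0, 0) = (0, 0) := by
  simp only [flatTransition, knotTransition_zero, locAng_circlePoint_zero]

/-- Near `θ = 0` the flat transition map fixes the zero section: `(θ, 0) ↦ (θ, 0)`. [folklore] -/
theorem flatTransition_zero_of_mem {θ : ℝ} (hθ : θ ∈ Ioo (-π) π) :
    flatTransition ν₁ ν₂ (θ, 0) = (θ, 0) := by
  simp only [flatTransition, knotTransition_zero, locAng_circlePoint hθ]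

/-- The flat transition map is `C^∞` at `(0, 0)`. [folklore] -/
theorem contDiffAt_flatTransition : ContDiffAt ℝ ∞ (flatTransition ν₁ ν₂) (0, 0) := by
  rw [← contMDiffAt_iff_contDiffAt]
  have hc := contMDiff_circlePoint_prod (((0 : ℝ), (0 : 𝔼 2)) : ℝ × 𝔼 2)
  have hτ : ContMDiffAt I𝕋₁ I𝕋₁ ∞ (knotTransition ν₁ ν₂)
      ((circlePoint (0 : ℝ), (0 : 𝔼 2)) : (𝕊 1) × 𝔼 2) :=
    contMDiffAt_knotTransition ν₁ ν₂ (mem_knotTransitionDom_zero ν₁ ν₂ _)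
  have hτc : ContMDiffAt 𝓘(ℝ, ℝ × 𝔼 2) I𝕋₁ ∞
      (knotTransition ν₁ ν₂ ∘ fun q : ℝ × 𝔼 2 => ((circlePoint q.1, q.2) : (𝕊 1) × 𝔼 2))
      ((0 : ℝ), (0 : 𝔼 2)) :=
    ContMDiffAt.comp ((0 : ℝ), (0 : 𝔼 2))
      (f := fun q : ℝ × 𝔼 2 => ((circlePoint q.1, q.2) : (𝕊 1) × 𝔼 2)) hτ hc
  have hpt : (knotTransition ν₁ ν₂ ∘ fun q : ℝ × 𝔼 2 => ((circlePoint q.1, q.2) : (𝕊 1) × 𝔼 2))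
      ((0 : ℝ), (0 : 𝔼 2)) = (circlePoint 0, 0) := knotTransition_zero ν₁ ν₂ _
  have hout : ContMDiffAt I𝕋₁ 𝓘(ℝ, ℝ × 𝔼 2) ∞
      (fun p : (𝕊 1) × 𝔼 2 => ((locAng p.1, p.2) : ℝ × 𝔼 2))
      ((knotTransition ν₁ ν₂ ∘ fun q : ℝ × 𝔼 2 => ((circlePoint q.1, q.2) : (𝕊 1) × 𝔼 2))
        ((0 : ℝ), (0 : 𝔼 2))) := by
    rw [hpt]
    have h1 : ContMDiffAt I𝕋₁ 𝓘(ℝ, ℝ) ∞ (locAng ∘ (Prod.fst : (𝕊 1) × 𝔼 2 → 𝕊 1))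
        ((circlePoint (0 : ℝ), (0 : 𝔼 2)) : (𝕊 1) × 𝔼 2) :=
      ContMDiffAt.comp ((circlePoint (0 : ℝ), (0 : 𝔼 2)) : (𝕊 1) × 𝔼 2) (g := locAng)
        (f := (Prod.fst : (𝕊 1) × 𝔼 2 → 𝕊 1))
        (contMDiffAt_locAng circlePoint_zero_ne_ptB) contMDiffAt_fst
    exact h1.prodMk_space contMDiffAt_snd
  exact ContMDiffAt.comp ((0 : ℝ), (0 : 𝔼 2))
    (g := fun p : (𝕊 1) × 𝔼 2 => ((locAng p.1, p.2) : ℝ × 𝔼 2)) hout hτc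

/-- **The fibre derivative has positive determinant** for two *oriented* tubular neighbourhoods of
the same knot: in the angle coordinate the Jacobian frame `(ν₁, ∂_θ ν₁, ∂_{w₀} ν₁, ∂_{w₁} ν₁)` at
`(0, 0)` is obtained from that of `ν₂` by the block triangular differential of the transition map
(the `θ`-row is unchanged, the fibre rows become `βₖ ∂_θ ν₂ + Σⱼ Aⱼₖ ∂_{wⱼ} ν₂`), so the two
`det_pos` determinants differ by the factor `det A(circlePoint 0)`. [folklore] -/
theorem det_knotFibreDeriv_pos :
    0 < knotFibreDeriv ν₁ ν₂ (circlePoint 0) (EuclideanSpace.single 0 1) 0 *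
          knotFibreDeriv ν₁ ν₂ (circlePoint 0) (EuclideanSpace.single 1 1) 1 -
        knotFibreDeriv ν₁ ν₂ (circlePoint 0) (EuclideanSpace.single 0 1) 1 *
          knotFibreDeriv ν₁ ν₂ (circlePoint 0) (EuclideanSpace.single 1 1) 0 := by
  set q₀ : ℝ × 𝔼 2 := ((0 : ℝ), (0 : 𝔼 2)) with hq₀
  set A := knotFibreDeriv ν₁ ν₂ (circlePoint 0) with hA
  set T₂ : ℝ × 𝔼 2 →L[ℝ] 𝔼 4 := fderiv ℝ ν₂.paramCoe q₀ with hT₂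
  -- the derivative of the flat transition map at `(0, 0)`
  have hF := contDiffAt_flatTransition ν₁ ν₂
  set D : ℝ × 𝔼 2 →L[ℝ] ℝ × 𝔼 2 := fderiv ℝ (flatTransition ν₁ ν₂) q₀ with hD
  have hDd : HasFDerivAt (flatTransition ν₁ ν₂) D q₀ :=
    (hF.differentiableAt (by simp)).hasFDerivAt
  -- `D (1, 0) = (1, 0)`
  have hD1 : D ((1 : ℝ), (0 : 𝔼 2)) = ((1 : ℝ), (0 : 𝔼 2)) := by
    have hcurve : HasDerivAt (fun θ : ℝ => ((θ, (0 : 𝔼 2)) : ℝ × 𝔼 2))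
        (((1 : ℝ), (0 : 𝔼 2)) : ℝ × 𝔼 2) 0 :=
      (hasDerivAt_id (0 : ℝ)).prodMk (hasDerivAt_const (0 : ℝ) (0 : 𝔼 2))
    have h1 : HasDerivAt (fun θ : ℝ => flatTransition ν₁ ν₂ (θ, 0))
        (D ((1 : ℝ), (0 : 𝔼 2))) 0 := by
      have := hDd.comp_hasDerivAt (0 : ℝ) hcurve
      exact this
    have h2 : HasDerivAt (fun θ : ℝ => flatTransition ν₁ ν₂ (θ, 0))
        (((1 : ℝ), (0 : 𝔼 2)) : ℝ × 𝔼 2) 0 := by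
      refine hcurve.congr_of_eventuallyEq ?_
      filter_upwards [Ioo_mem_nhds (show -π < (0 : ℝ) by linarith [pi_pos]) pi_pos] with θ hθ
      exact flatTransition_zero_of_mem ν₁ ν₂ hθ
    exact h1.unique h2
  -- `(D (0, v)).2 = A v`
  have hD2 : ∀ v : 𝔼 2, (D ((0 : ℝ), v)).2 = A v := by
    have hinr : HasFDerivAt (fun w : 𝔼 2 => (((0 : ℝ), w) : ℝ × 𝔼 2))
        (ContinuousLinearMap.inr ℝ ℝ (𝔼 2)) 0 := (ContinuousLinearMap.inr ℝ ℝ (𝔼 2)).hasFDerivAt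
    have h1 : HasFDerivAt (fun w : 𝔼 2 => (flatTransition ν₁ ν₂ ((0 : ℝ), w)).2)
        ((ContinuousLinearMap.snd ℝ ℝ (𝔼 2)).comp (D.comp (ContinuousLinearMap.inr ℝ ℝ (𝔼 2))))
        0 := by
      have hc := hDd.comp (0 : 𝔼 2) hinr
      exact (ContinuousLinearMap.snd ℝ ℝ (𝔼 2)).hasFDerivAt.comp (0 : 𝔼 2) hc
    have h2 : (fun w : 𝔼 2 => (flatTransition ν₁ ν₂ ((0 : ℝ), w)).2) =
        fun w : 𝔼 2 => (knotTransition ν₁ ν₂ (circlePoint 0, w)).2 := by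
      funext w; rfl
    rw [h2] at h1
    intro v
    have := congrArg (fun f : 𝔼 2 →L[ℝ] 𝔼 2 => f v) h1.fderiv
    -- `this : fderiv … v = (snd ∘ D ∘ inr) v`
    show (D ((0 : ℝ), v)).2 = fderiv ℝ (fun w : 𝔼 2 => (knotTransition ν₁ ν₂ (circlePoint 0, w)).2) 0 v
    rw [this]
    rfl
  -- chain rule: `Dν₁ = Dν₂ ∘ D` at `(0, 0)` (in the angle coordinate, values in `ℝ⁴`)
  have hdom : {q : ℝ × 𝔼 2 | ((circlePoint q.1, q.2) : (𝕊 1) × 𝔼 2) ∈ knotTransitionDom ν₁ ν₂}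
      ∈ 𝓝 q₀ := by
    have hc : Continuous fun q : ℝ × 𝔼 2 => ((circlePoint q.1, q.2) : (𝕊 1) × 𝔼 2) :=
      contMDiff_circlePoint_prod.continuous
    refine hc.continuousAt.preimage_mem_nhds ((isOpen_knotTransitionDom ν₁ ν₂).mem_nhds ?_)
    exact mem_knotTransitionDom_zero ν₁ ν₂ (circlePoint 0)
  have hT₂d : HasFDerivAt ν₂.paramCoe T₂ (flatTransition ν₁ ν₂ q₀) := by
    rw [hq₀, flatTransition_zero_zero]
    exact ((ν₂.contDiff_paramCoe.differentiable (by simp)) _).hasFDerivAt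
  have hcomp : HasFDerivAt (ν₂.paramCoe ∘ flatTransition ν₁ ν₂) (T₂.comp D) q₀ := hT₂d.comp q₀ hDd
  have hT₁d : HasFDerivAt ν₁.paramCoe (T₂.comp D) q₀ := by
    refine hcomp.congr_of_eventuallyEq ?_
    filter_upwards [hdom] with q hq
    exact (paramCoe_flatTransition ν₁ ν₂ hq).symm
  have hT₁ : fderiv ℝ ν₁.paramCoe q₀ = T₂.comp D := hT₁d.fderiv
  -- the fibre rows of `ν₁` in terms of the rows of `ν₂`
  have hrow : ∀ k : Fin 2, (T₂.comp D) ((0 : ℝ), EuclideanSpace.single k (1 : ℝ)) =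
      (D ((0 : ℝ), EuclideanSpace.single k (1 : ℝ))).1 • T₂ ((1 : ℝ), (0 : 𝔼 2)) +
        A (EuclideanSpace.single k 1) 0 • T₂ ((0 : ℝ), EuclideanSpace.single 0 (1 : ℝ)) +
        A (EuclideanSpace.single k 1) 1 • T₂ ((0 : ℝ), EuclideanSpace.single 1 (1 : ℝ)) := by
    intro k
    have hsplit : D ((0 : ℝ), EuclideanSpace.single k (1 : ℝ)) =
        (D ((0 : ℝ), EuclideanSpace.single k (1 : ℝ))).1 • (((1 : ℝ), (0 : 𝔼 2)) : ℝ × 𝔼 2) +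
          A (EuclideanSpace.single k 1) 0 • (((0 : ℝ), EuclideanSpace.single 0 (1 : ℝ)) : ℝ × 𝔼 2) +
          A (EuclideanSpace.single k 1) 1 • (((0 : ℝ), EuclideanSpace.single 1 (1 : ℝ)) : ℝ × 𝔼 2) := by
      refine Prod.ext ?_ ?_
      · simp
      · rw [hD2]
        ext i
        fin_cases i <;> simp
    rw [ContinuousLinearMap.comp_apply]
    conv_lhs => rw [hsplit]
    rw [map_add, map_add, map_smul, map_smul, map_smul]
  -- the two positive frame determinants
  have hdet₁ := ν₁.tubeFrameDet_paramCoe_pos q₀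
  have hdet₂ := ν₂.tubeFrameDet_paramCoe_pos q₀
  have hr₀ : ν₁.paramCoe q₀ = ν₂.paramCoe q₀ := by
    simp [hq₀, Knot.TubularNbhd.paramCoe, Knot.TubularNbhd.param_apply]
  rw [tubeFrameDet_def, hT₁, hr₀, ContinuousLinearMap.comp_apply, hD1, hrow 0, hrow 1,
    frameDet_rows_comb] at hdet₁
  rw [tubeFrameDet_def] at hdet₂
  exact (mul_pos_iff_of_pos_right hdet₂).1 hdet₁

end Orientation


/-! ### The rotation field attached to two oriented tubular neighbourhoods -/

section Frame

variable {K : 𝕊 1 → 𝕊 3} (ν₁ ν₂ : Knot.TubularNbhd K)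

/-- The first column `A(x) e₀` of the fibre derivative. [folklore] -/
def knotFrameCol (x : 𝕊 1) : 𝔼 2 := knotFibreDeriv ν₁ ν₂ x planeE0

/-- The first column of the (invertible) fibre derivative is nonzero. [folklore] -/
theorem knotFrameCol_ne_zero (x : 𝕊 1) : knotFrameCol ν₁ ν₂ x ≠ 0 := by
  intro h
  have h0 : planeE0 = 0 := injective_knotFibreDeriv ν₁ ν₂ x (by rw [map_zero]; exact h)
  have := congrArg (fun w : 𝔼 2 => w 0) h0
  simp at this

/-- The first column depends smoothly on the point of the knot. [folklore] -/
theorem contMDiff_knotFrameCol : ContMDiff (𝓡 1) 𝓘(ℝ, 𝔼 2) ∞ (knotFrameCol ν₁ ν₂) :=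
  (contMDiff_knotFibreDeriv ν₁ ν₂).clm_apply contMDiff_const

/-- The **frame vector** `u(x) = A(x) e₀ / ‖A(x) e₀‖`, the unit vector by which the fibre over `x`
is rotated. [folklore] -/
def knotFrameVec (x : 𝕊 1) : 𝔼 2 := NormedSpace.normalize (knotFrameCol ν₁ ν₂ x)

/-- The frame vector is a unit vector. [folklore] -/
theorem norm_knotFrameVec (x : 𝕊 1) : ‖knotFrameVec ν₁ ν₂ x‖ = 1 :=
  NormedSpace.norm_normalize (knotFrameCol_ne_zero ν₁ ν₂ x)

/-- The frame vector depends smoothly on the point of the knot. [folklore] -/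
theorem contMDiff_knotFrameVec : ContMDiff (𝓡 1) 𝓘(ℝ, 𝔼 2) ∞ (knotFrameVec ν₁ ν₂) := by
  have hinv : ContMDiff (𝓡 1) 𝓘(ℝ, ℝ) ∞ fun x => ‖knotFrameCol ν₁ ν₂ x‖⁻¹ := by
    intro x
    have h1 : ContDiffAt ℝ ∞ (fun a : 𝔼 2 => ‖a‖⁻¹) (knotFrameCol ν₁ ν₂ x) :=
      (contDiffAt_norm ℝ (knotFrameCol_ne_zero ν₁ ν₂ x)).inv
        (norm_ne_zero_iff.2 (knotFrameCol_ne_zero ν₁ ν₂ x))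
    exact h1.contMDiffAt.comp x (contMDiff_knotFrameCol ν₁ ν₂ x)
  exact hinv.smul (contMDiff_knotFrameCol ν₁ ν₂)

/-- The frame vector as a smooth map `S¹ → S¹` (the **rotation field** of the pair `ν₁`, `ν₂`).
[folklore] -/
def knotFrameUnit (x : 𝕊 1) : 𝕊 1 :=
  ⟨knotFrameVec ν₁ ν₂ x, mem_sphere_zero_iff_norm.2 (norm_knotFrameVec ν₁ ν₂ x)⟩

/-- The rotation field, as a vector of the plane. [folklore] -/
@[simp] theorem coe_knotFrameUnit (x : 𝕊 1) :
    ((knotFrameUnit ν₁ ν₂ x : 𝕊 1) : 𝔼 2) = knotFrameVec ν₁ ν₂ x := rfl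

/-- The rotation field `S¹ → S¹` is smooth. [folklore] -/
theorem contMDiff_knotFrameUnit : ContMDiff (𝓡 1) (𝓡 1) ∞ (knotFrameUnit ν₁ ν₂) :=
  (contMDiff_knotFrameVec ν₁ ν₂).codRestrict_sphere _

/-- The **orientation function** `⟪A(x) e₁, J u(x)⟫` (sign of `det A(x)`). [folklore] -/
def knotFrameSign (x : 𝕊 1) : ℝ :=
  ⟪knotFibreDeriv ν₁ ν₂ x planeE1, quarterTurn (knotFrameVec ν₁ ν₂ x)⟫

/-- The orientation function does not vanish. [folklore] -/
theorem knotFrameSign_ne_zero (x : 𝕊 1) : knotFrameSign ν₁ ν₂ x ≠ 0 :=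
  inner_frame_ne_zero (injective_knotFibreDeriv ν₁ ν₂ x)

/-- The orientation function is continuous. [folklore] -/
theorem continuous_knotFrameSign : Continuous (knotFrameSign ν₁ ν₂) := by
  have h1 : Continuous fun x => knotFibreDeriv ν₁ ν₂ x planeE1 :=
    ((contMDiff_knotFibreDeriv ν₁ ν₂).clm_apply contMDiff_const).continuous
  have h2 : Continuous fun x => quarterTurn (knotFrameVec ν₁ ν₂ x) :=
    contDiff_quarterTurn.continuous.comp (contMDiff_knotFrameVec ν₁ ν₂).continuous
  exact h1.inner h2

/-- The orientation function is positive at `circlePoint 0` (`det_knotFibreDeriv_pos`). [folklore] -/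
theorem knotFrameSign_circlePoint_zero_pos : 0 < knotFrameSign ν₁ ν₂ (circlePoint 0) := by
  have hdet := det_knotFibreDeriv_pos ν₁ ν₂
  set A := knotFibreDeriv ν₁ ν₂ (circlePoint 0) with hA
  have hcol : knotFrameCol ν₁ ν₂ (circlePoint 0) = A planeE0 := rfl
  have hne := knotFrameCol_ne_zero ν₁ ν₂ (circlePoint 0)
  rw [hcol] at hne
  have hn : 0 < ‖A planeE0‖ := norm_pos_iff.2 hne
  rw [knotFrameSign, knotFrameVec, hcol, NormedSpace.normalize, quarterTurn_smul', inner_smul_right,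
    inner_quarterTurn_eq_det]
  refine mul_pos (inv_pos.2 hn) ?_
  have e0 : (planeE0 : 𝔼 2) = EuclideanSpace.single 0 1 := rfl
  have e1 : (planeE1 : 𝔼 2) = EuclideanSpace.single 1 1 := rfl
  rw [e0, e1]
  linarith [hdet]

/-- The circle is preconnected. [folklore] -/
theorem preconnectedSpace_circle : PreconnectedSpace (𝕊 1) :=
  Subtype.preconnectedSpace (isPreconnected_sphere
    (by rw [← Module.finrank_eq_rank, finrank_euclideanSpace_fin]; norm_num) _ _)

/-- **The orientation function is positive along the (connected) knot**: no sign change by the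
intermediate value theorem, and positivity at `circlePoint 0`. For oriented tubular neighbourhoods
the orthogonal factor of the fibre derivative is therefore a rotation. [folklore] -/
theorem knotFrameSign_pos (x : 𝕊 1) : 0 < knotFrameSign ν₁ ν₂ x := by
  haveI := preconnectedSpace_circle
  have hne := knotFrameSign_ne_zero ν₁ ν₂
  have hc := continuous_knotFrameSign ν₁ ν₂
  have h0 := knotFrameSign_circlePoint_zero_pos ν₁ ν₂
  by_contra hx
  have hx : knotFrameSign ν₁ ν₂ x ≤ 0 := not_lt.1 hx
  have hmem : (0 : ℝ) ∈ Icc (knotFrameSign ν₁ ν₂ x) (knotFrameSign ν₁ ν₂ (circlePoint 0)) :=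
    ⟨hx, h0.le⟩
  obtain ⟨z, hz⟩ := intermediate_value_univ x (circlePoint 0) hc hmem
  exact hne z hz

/-- The **orthogonal frame** `Q(x) = [u(x), J u(x)]` of the transition map: a smooth family of
rotations of the fibre (the orthogonal factor of the `QR` decomposition of `A(x)`; no reflection,
the tubular neighbourhoods being oriented). [folklore] -/
def knotFrame (x : 𝕊 1) : 𝔼 2 ≃ₗᵢ[ℝ] 𝔼 2 :=
  frameIsometry (knotFrameVec ν₁ ν₂ x) 1 (norm_knotFrameVec ν₁ ν₂ x) (by norm_num)

/-- The orthogonal frame, unfolded: `Q(x) w = w₀ u(x) + w₁ J u(x)` (complex multiplication of `w`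
by the unit vector `u(x)`). [folklore] -/
theorem knotFrame_apply (x : 𝕊 1) (w : 𝔼 2) :
    knotFrame ν₁ ν₂ x w = w 0 • knotFrameVec ν₁ ν₂ x + w 1 • quarterTurn (knotFrameVec ν₁ ν₂ x) := by
  rw [knotFrame, frameIsometry_apply, one_mul]

/-- The orthogonal frame is the frame map of the first column. [folklore] -/
theorem knotFrame_eq_frameMap (x : 𝕊 1) (w : 𝔼 2) :
    knotFrame ν₁ ν₂ x w = frameMap (NormedSpace.normalize (knotFibreDeriv ν₁ ν₂ x planeE0)) 1 w := by
  rw [knotFrame_apply, frameMap_apply, one_mul]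
  rfl

/-- **The orthogonal frame depends smoothly on `(x, w)`.** [folklore] -/
theorem contMDiff_knotFrame :
    ContMDiff I𝕋₁ 𝓘(ℝ, 𝔼 2) ∞ fun p : (𝕊 1) × 𝔼 2 => knotFrame ν₁ ν₂ p.1 p.2 := by
  have hcoord : ∀ i : Fin 2, ContMDiff I𝕋₁ 𝓘(ℝ, ℝ) ∞ fun p : (𝕊 1) × 𝔼 2 => p.2 i := fun i =>
    ((EuclideanSpace.proj (𝕜 := ℝ) i).contDiff.contMDiff).comp contMDiff_snd
  have hu : ContMDiff I𝕋₁ 𝓘(ℝ, 𝔼 2) ∞ fun p : (𝕊 1) × 𝔼 2 => knotFrameVec ν₁ ν₂ p.1 :=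
    (contMDiff_knotFrameVec ν₁ ν₂).comp contMDiff_fst
  have hJ : ContMDiff I𝕋₁ 𝓘(ℝ, 𝔼 2) ∞ fun p : (𝕊 1) × 𝔼 2 => quarterTurn (knotFrameVec ν₁ ν₂ p.1) :=
    contDiff_quarterTurn.comp_contMDiff hu
  have h : ContMDiff I𝕋₁ 𝓘(ℝ, 𝔼 2) ∞ fun p : (𝕊 1) × 𝔼 2 =>
      p.2 0 • knotFrameVec ν₁ ν₂ p.1 + p.2 1 • quarterTurn (knotFrameVec ν₁ ν₂ p.1) :=
    ((hcoord 0).smul hu).add ((hcoord 1).smul hJ)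
  refine h.congr fun p => ?_
  exact knotFrame_apply ν₁ ν₂ p.1 p.2

/-- **The straight line from the fibre derivative to its orthogonal frame stays injective**
(`injective_lineToFrame` along the knot, with the positive orientation sign). [folklore] -/
theorem injective_line_knotFrame (x : 𝕊 1) {t : ℝ} (ht : t ∈ Icc (0 : ℝ) 1) :
    Injective fun w : 𝔼 2 => (1 - t) • knotFibreDeriv ν₁ ν₂ x w + t • knotFrame ν₁ ν₂ x w := by
  have hsgn : 0 < (1 : ℝ) * knotFrameSign ν₁ ν₂ x := by
    rw [one_mul]; exact knotFrameSign_pos ν₁ ν₂ x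
  have h := injective_lineToFrame (injective_knotFibreDeriv ν₁ ν₂ x) (s := 1) (by norm_num) hsgn ht
  intro w w' hww'
  apply h
  show ((1 - t) • knotFibreDeriv ν₁ ν₂ x +
      t • frameMap (NormedSpace.normalize (knotFibreDeriv ν₁ ν₂ x planeE0)) 1) w =
    ((1 - t) • knotFibreDeriv ν₁ ν₂ x +
      t • frameMap (NormedSpace.normalize (knotFibreDeriv ν₁ ν₂ x planeE0)) 1) w'
  simp only [add_apply, FunLike.coe_smul, Pi.smul_apply]
  rw [← knotFrame_eq_frameMap, ← knotFrame_eq_frameMap]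
  exact hww'

end Frame


/-! ### A stereographic chart of `S³` and the straight-line isotopy of one component -/

section Chart

/-- The stereographic chart of `S³` from the antipode of `-pt`, i.e. with source `S³ ∖ {pt}` and
target all of `ℝ³` (Mathlib's `chartAt (𝔼 3) (-pt) = stereographic'`). [folklore] -/
def stereoChart (pt : 𝕊 3) : OpenPartialHomeomorph (𝕊 3) (𝔼 3) := chartAt (𝔼 3) (-pt)

variable (pt : 𝕊 3)

/-- The source of the stereographic chart is the complement of the pole. [folklore] -/
theorem stereoChart_source : (stereoChart pt).source = {pt}ᶜ := by
  haveI : Fact (Module.finrank ℝ (EuclideanSpace ℝ (Fin (3 + 1))) = 3 + 1) :=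
    ⟨finrank_euclideanSpace_fin⟩
  show (stereographic' 3 (-(-pt))).source = {pt}ᶜ
  rw [stereographic'_source, neg_neg]

/-- The target of the stereographic chart is all of `ℝ³`. [folklore] -/
theorem stereoChart_target : (stereoChart pt).target = univ := by
  haveI : Fact (Module.finrank ℝ (EuclideanSpace ℝ (Fin (3 + 1))) = 3 + 1) :=
    ⟨finrank_euclideanSpace_fin⟩
  show (stereographic' 3 (-(-pt))).target = univ
  exact stereographic'_target _

/-- The stereographic chart is smooth on its source. [folklore] -/
theorem contMDiffOn_stereoChart :
    ContMDiffOn (𝓡 3) (𝓡 3) ∞ (stereoChart pt) (stereoChart pt).source :=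
  contMDiffOn_chart

/-- The inverse of the stereographic chart is smooth (everywhere, the target being `ℝ³`).
[folklore] -/
theorem contMDiff_stereoChart_symm : ContMDiff (𝓡 3) (𝓡 3) ∞ (stereoChart pt).symm := by
  have h := contMDiffOn_chart_symm (I := 𝓡 3) (x := -pt) (n := ∞)
  rw [show chartAt (𝔼 3) (-pt) = stereoChart pt from rfl, stereoChart_target] at h
  exact contMDiffOn_univ.1 h

/-- The differential of the stereographic chart is injective on the source. [folklore] -/
theorem injective_mfderiv_stereoChart {p : 𝕊 3} (hp : p ∈ (stereoChart pt).source) :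
    Injective (mfderiv (𝓡 3) (𝓡 3) (stereoChart pt) p) :=
  (mdifferentiable_chart (I := 𝓡 3) (-pt)).mfderiv_injective hp

/-- The stereographic chart is differentiable on its source. [folklore] -/
theorem mdifferentiableAt_stereoChart {p : 𝕊 3} (hp : p ∈ (stereoChart pt).source) :
    MDifferentiableAt (𝓡 3) (𝓡 3) (stereoChart pt) p :=
  ((contMDiffOn_stereoChart pt).contMDiffAt ((stereoChart pt).open_source.mem_nhds hp)).mdifferentiableAt
    (by simp)

variable {pt}

/-- The dimension of the tangent spaces of the tube `S¹ × ℝ²` equals that of `ℝ³`. [folklore] -/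
theorem finrank_tangentSpace_circleTube (p : (𝕊 1) × 𝔼 2) :
    Module.finrank ℝ (TangentSpace I𝕋₁ p) = Module.finrank ℝ (𝔼 3) := by
  show Module.finrank ℝ (EuclideanSpace ℝ (Fin 1) × 𝔼 2) = Module.finrank ℝ (𝔼 3)
  simp

variable {K : 𝕊 1 → 𝕊 3} (ν₁ ν₂ : Knot.TubularNbhd K)

/-- **The derivative of the straight-line isotopy is injective along the knot** (one component).
With `σ` a stereographic chart containing `range ν₂`, `e₁ = σ ∘ ν₁`, `e₂ = σ ∘ ν₂`,
`Qm = id × Q` the fibrewise orthogonal frame, and `P` any map with `P ∘ e₁ = e₂ ∘ Qm` on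
`ν₁⁻¹(range ν₂)` which is differentiable at the points `e₁ (x, 0)`: the maps
`id + t (DP - id)` are injective at `e₁ (x, 0)` for `0 ≤ t ≤ 1` — composed with the surjection
`De₁ (x, 0)` they equal `De₂ (x, 0) ∘ ((1 - t) Dτ + t DQm)(x, 0)`, block triangular with injective
diagonal blocks `id` and `(1 - t) A(x) + t Q(x)`. Kosinski (1993), III.(3.5). [folklore] -/
theorem injective_slDeriv_component (hν₂src : ∀ q, ν₂ q ∈ (stereoChart pt).source)
    {P : 𝔼 3 → 𝔼 3}
    (hPe₁ : ∀ q ∈ knotTransitionDom ν₁ ν₂, P (stereoChart pt (ν₁ q)) =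
      stereoChart pt (ν₂ (circleFibrewiseMap (knotFrame ν₁ ν₂) q)))
    (hPd : ∀ x : 𝕊 1, DifferentiableAt ℝ P (stereoChart pt (ν₁ (x, 0))))
    (x : 𝕊 1) {t : ℝ} (ht : t ∈ Icc (0 : ℝ) 1) :
    Injective (slDeriv t (fderiv ℝ P (stereoChart pt (ν₁ (x, 0))))) := by
  set σ := stereoChart pt with hσ
  set g : (𝕊 1) → (𝔼 2 ≃ₗᵢ[ℝ] 𝔼 2) := knotFrame ν₁ ν₂ with hg
  have hgsmooth : ContMDiff I𝕋₁ 𝓘(ℝ, 𝔼 2) ∞ (fun p : (𝕊 1) × 𝔼 2 => g p.1 p.2) :=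
    contMDiff_knotFrame ν₁ ν₂
  set Qm : (𝕊 1) × 𝔼 2 → (𝕊 1) × 𝔼 2 := circleFibrewiseMap g with hQm
  have hQmsm : ContMDiff I𝕋₁ I𝕋₁ ∞ Qm := contMDiff_circleFibrewiseMap hgsmooth
  set e₁ : (𝕊 1) × 𝔼 2 → 𝔼 3 := fun q => σ (ν₁ q) with he₁
  set e₂ : (𝕊 1) × 𝔼 2 → 𝔼 3 := fun q => σ (ν₂ q) with he₂
  have hσsm := contMDiffOn_stereoChart pt
  have hν₁src : ∀ q ∈ knotTransitionDom ν₁ ν₂, ν₁ q ∈ σ.source := fun q hq => by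
    obtain ⟨q', hq'⟩ := hq
    rw [← hq']
    exact hν₂src q'
  have hdom_nhds : ∀ x : 𝕊 1, knotTransitionDom ν₁ ν₂ ∈ 𝓝 ((x, (0 : 𝔼 2)) : (𝕊 1) × 𝔼 2) :=
    fun x => (isOpen_knotTransitionDom ν₁ ν₂).mem_nhds (mem_knotTransitionDom_zero ν₁ ν₂ x)
  have he₁sm : ∀ q ∈ knotTransitionDom ν₁ ν₂, ContMDiffAt I𝕋₁ (𝓡 3) ∞ e₁ q := fun q hq =>
    (hσsm.contMDiffAt (σ.open_source.mem_nhds (hν₁src q hq))).comp q (ν₁.contMDiffAt_coe q)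
  have he₂sm : ∀ q, ContMDiffAt I𝕋₁ (𝓡 3) ∞ e₂ q := fun q =>
    (hσsm.contMDiffAt (σ.open_source.mem_nhds (hν₂src q))).comp q (ν₂.contMDiffAt_coe q)
  set p₀ : (𝕊 1) × 𝔼 2 := (x, 0) with hp₀
  have hp₀dom : p₀ ∈ knotTransitionDom ν₁ ν₂ := mem_knotTransitionDom_zero ν₁ ν₂ x
  -- differentials of `e₁`, `e₂`
  letI : FiniteDimensional ℝ (TangentSpace I𝕋₁ p₀) :=
    inferInstanceAs (FiniteDimensional ℝ (EuclideanSpace ℝ (Fin 1) × 𝔼 2))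
  set M₁ : TangentSpace I𝕋₁ p₀ →L[ℝ] 𝔼 3 := mfderiv I𝕋₁ (𝓡 3) e₁ p₀ with hM₁
  set M₂ : TangentSpace I𝕋₁ p₀ →L[ℝ] 𝔼 3 := mfderiv I𝕋₁ (𝓡 3) e₂ p₀ with hM₂
  have hM₁d : HasMFDerivAt I𝕋₁ (𝓡 3) e₁ p₀ M₁ :=
    ((he₁sm p₀ hp₀dom).mdifferentiableAt (by simp)).hasMFDerivAt
  have hM₂d : HasMFDerivAt I𝕋₁ (𝓡 3) e₂ p₀ M₂ :=
    ((he₂sm p₀).mdifferentiableAt (by simp)).hasMFDerivAt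
  have hσinj : ∀ p ∈ σ.source, Injective (mfderiv (𝓡 3) (𝓡 3) σ p) := fun p hp =>
    injective_mfderiv_stereoChart pt hp
  have hσd : ∀ p ∈ σ.source, MDifferentiableAt (𝓡 3) (𝓡 3) σ p := fun p hp =>
    mdifferentiableAt_stereoChart pt hp
  have hM₂inj : Injective M₂ := by
    have hc := mfderiv_comp p₀ (hσd _ (hν₂src p₀))
      ((ν₂.contMDiffAt_coe p₀).mdifferentiableAt (by simp))
    rw [hM₂, show e₂ = σ ∘ ν₂ from rfl, hc]
    intro u v huv
    exact ν₂.injective_mfderiv_coe _ (hσinj _ (hν₂src p₀) huv)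
  have hM₁inj : Injective M₁ := by
    have hc := mfderiv_comp p₀ (hσd _ (hν₁src p₀ hp₀dom))
      ((ν₁.contMDiffAt_coe p₀).mdifferentiableAt (by simp))
    rw [hM₁, show e₁ = σ ∘ ν₁ from rfl, hc]
    intro u v huv
    exact ν₁.injective_mfderiv_coe _ (hσinj _ (hν₁src p₀ hp₀dom) huv)
  have hM₁surj : Surjective M₁ :=
    (LinearMap.injective_iff_surjective_of_finrank_eq_finrank
      (f := (M₁ : TangentSpace I𝕋₁ p₀ →ₗ[ℝ] 𝔼 3)) (finrank_tangentSpace_circleTube p₀)).1 hM₁inj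
  -- the transition map: `e₁ = e₂ ∘ τ` near `p₀`, so `M₁ = M₂ ∘ Dτ`
  set Tτ : TangentSpace I𝕋₁ p₀ →L[ℝ] TangentSpace I𝕋₁ p₀ :=
    mfderiv I𝕋₁ I𝕋₁ (knotTransition ν₁ ν₂) p₀ with hTτ
  have hTτd : HasMFDerivAt I𝕋₁ I𝕋₁ (knotTransition ν₁ ν₂) p₀ Tτ :=
    (mdifferentiableAt_knotTransition ν₁ ν₂ x).hasMFDerivAt
  have he₁τ : e₁ =ᶠ[𝓝 p₀] (e₂ ∘ knotTransition ν₁ ν₂) := by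
    filter_upwards [hdom_nhds x] with q hq
    simp only [he₁, he₂, comp_apply, apply_knotTransition ν₁ ν₂ hq]
  have hM₁eq : M₁ = M₂.comp Tτ := by
    have h2' : HasMFDerivAt I𝕋₁ (𝓡 3) e₂ (knotTransition ν₁ ν₂ p₀) M₂ := by
      rw [hp₀, knotTransition_zero]; exact hM₂d
    have hc := (h2'.comp p₀ hTτd).congr_of_eventuallyEq he₁τ
    exact hc.mfderiv
  -- the fibrewise map: `P ∘ e₁ = e₂ ∘ Qm` near `p₀`
  set TQ : TangentSpace I𝕋₁ p₀ →L[ℝ] TangentSpace I𝕋₁ p₀ := mfderiv I𝕋₁ I𝕋₁ Qm p₀ with hTQ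
  have hTQd : HasMFDerivAt I𝕋₁ I𝕋₁ Qm p₀ TQ := ((hQmsm p₀).mdifferentiableAt (by simp)).hasMFDerivAt
  have hline : (slIsotopy P t ∘ e₁) =ᶠ[𝓝 p₀] ((1 - t) • e₁ + t • (e₂ ∘ Qm)) := by
    filter_upwards [hdom_nhds x] with q hq
    simp only [comp_apply, slIsotopy, Pi.add_apply, Pi.smul_apply, he₁, he₂, hPe₁ q hq]
    rw [smul_sub, sub_smul, one_smul]
    abel
  -- derivative of the left-hand side
  have hPderiv : HasFDerivAt P (fderiv ℝ P (e₁ p₀)) (e₁ p₀) := (hPd x).hasFDerivAt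
  have hh : HasMFDerivAt (𝓡 3) (𝓡 3) (slIsotopy P t) (e₁ p₀) (slDeriv t (fderiv ℝ P (e₁ p₀))) :=
    hasMFDerivAt_iff_hasFDerivAt.2 (hasFDerivAt_slIsotopy' t hPderiv)
  have hL : HasMFDerivAt I𝕋₁ (𝓡 3) (slIsotopy P t ∘ e₁) p₀
      ((slDeriv t (fderiv ℝ P (e₁ p₀))).comp M₁) := hh.comp p₀ hM₁d
  -- derivative of the right-hand side
  have he₂Q : HasMFDerivAt I𝕋₁ (𝓡 3) (e₂ ∘ Qm) p₀ (M₂.comp TQ) := by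
    have h2' : HasMFDerivAt I𝕋₁ (𝓡 3) e₂ (Qm p₀) M₂ := by
      rw [hQm, hp₀, circleFibrewiseMap_zero]; exact hM₂d
    exact h2'.comp p₀ hTQd
  have hR : HasMFDerivAt I𝕋₁ (𝓡 3) ((1 - t) • e₁ + t • (e₂ ∘ Qm)) p₀
      ((1 - t) • M₁ + t • (M₂.comp TQ)) :=
    (hM₁d.const_smul (1 - t)).add (he₂Q.const_smul t)
  have hEq : (slDeriv t (fderiv ℝ P (e₁ p₀))).comp M₁ = (1 - t) • M₁ + t • (M₂.comp TQ) :=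
    hL.mfderiv.symm.trans (hR.congr_of_eventuallyEq hline).mfderiv
  -- conclusion
  refine (injective_iff_map_eq_zero _).2 fun v hv => ?_
  obtain ⟨u, rfl⟩ := hM₁surj v
  have h1 : ((1 - t) • M₁ + t • (M₂.comp TQ)) u = 0 := by
    rw [← hEq]
    exact hv
  rw [hM₁eq] at h1
  have h2 : M₂ ((1 - t) • Tτ u + t • TQ u) = 0 := by
    rw [map_add, map_smul, map_smul]
    exact h1
  have h3 : (1 - t) • Tτ u + t • TQ u = 0 := (injective_iff_map_eq_zero _).1 hM₂inj _ h2
  -- second components: `((1 - t) A + t Q) u.2 = 0`, so `u.2 = 0`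
  have hT2 : (Tτ u).2 = knotFibreDeriv ν₁ ν₂ x u.2 := mfderiv_knotTransition_snd ν₁ ν₂ x u
  have hQ2 : (TQ u).2 = g x u.2 := mfderiv_circleFibrewiseMap_snd hgsmooth x u
  have h4 : (1 - t) • (Tτ u).2 + t • (TQ u).2 = (0 : 𝔼 2) := congrArg Prod.snd h3
  rw [hT2, hQ2] at h4
  have hu2 : u.2 = 0 := by
    have hinjl := injective_line_knotFrame ν₁ ν₂ x ht
    apply hinjl
    simp only [map_zero, smul_zero, add_zero]
    exact h4
  -- first components: `u.1 = 0`
  have hu : u = ((u.1, 0) : TangentSpace I𝕋₁ ((x, (0 : 𝔼 2)) : (𝕊 1) × 𝔼 2)) :=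
    Prod.ext rfl hu2
  have hT1 : Tτ ((u.1, 0) : TangentSpace I𝕋₁ ((x, (0 : 𝔼 2)) : (𝕊 1) × 𝔼 2)) = (u.1, 0) :=
    mfderiv_knotTransition_horizontal ν₁ ν₂ x u.1
  have hQ1 : TQ ((u.1, 0) : TangentSpace I𝕋₁ ((x, (0 : 𝔼 2)) : (𝕊 1) × 𝔼 2)) = (u.1, 0) :=
    mfderiv_circleFibrewiseMap_horizontal hgsmooth x u.1
  rw [hu, hT1, hQ1] at h3
  have h5 : (1 - t) • u.1 + t • u.1 = (0 : EuclideanSpace ℝ (Fin 1)) := congrArg Prod.fst h3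
  have hu1 : u.1 = 0 := by
    have : ((1 - t) + t) • u.1 = 0 := by rw [add_smul]; exact h5
    simpa using this
  rw [hu, hu1]
  exact map_zero M₁

end Chart


/-! ### The theorem -/

namespace Link

variable {ι : Type*} [Finite ι]

omit [Finite ι] in
/-- **A finite disjoint family of tubular neighbourhoods does not cover `S³`**: there is a point
off `⋃ᵢ range νᵢ` (otherwise, `S³` being connected, a single open tube `S¹ × ℝ²` would be all of
the compact `S³`). [folklore] -/
theorem exists_not_mem_range (L : Link ι) (ν : ∀ i, Knot.TubularNbhd (L.component i))
    (hdisj : Pairwise fun i j ↦ Disjoint (range (ν i)) (range (ν j))) :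
    ∃ pt : 𝕊 3, ∀ i, pt ∉ range (ν i) := by
  by_contra h
  push Not at h
  rcases isEmpty_or_nonempty ι with hι | ⟨⟨i₀⟩⟩
  · obtain ⟨i, -⟩ := h ⟨EuclideanSpace.single 0 1, by simp⟩
    exact hι.elim i
  -- `range (ν i₀)` is clopen, hence everything
  have hopen : IsOpen (range (ν i₀)) := (ν i₀).isOpenMap.isOpen_range
  have hclosed : IsClosed (range (ν i₀)) := by
    have hcompl : (range (ν i₀))ᶜ = ⋃ j ∈ {j | j ≠ i₀}, range (ν j) := by
      ext p
      simp only [mem_compl_iff, mem_iUnion, mem_setOf_eq, exists_prop]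
      constructor
      · intro hp
        obtain ⟨j, hj⟩ := h p
        exact ⟨j, fun hji => hp (hji ▸ hj), hj⟩
      · rintro ⟨j, hj, hpj⟩ hp
        exact Set.disjoint_left.1 (hdisj hj) hpj hp
    rw [← isOpen_compl_iff, hcompl]
    exact isOpen_biUnion fun j _ => (ν j).isOpenMap.isOpen_range
  haveI : PreconnectedSpace (𝕊 3) := Subtype.preconnectedSpace
    (isPreconnected_sphere (by rw [← Module.finrank_eq_rank, finrank_euclideanSpace_fin]; norm_num) _ _)
  have hne : (range (ν i₀)).Nonempty := range_nonempty_iff_nonempty.2 ⟨(circlePoint 0, 0)⟩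
  have huniv : range (ν i₀) = univ := IsClopen.eq_univ ⟨hclosed, hopen⟩ hne
  have hc : IsCompact (range ⇑(ν i₀)) := huniv ▸ isCompact_univ
  have hc' : IsCompact (univ : Set ((𝕊 1) × 𝔼 2)) := by
    rw [(ν i₀).isSmoothEmbedding_coe.isEmbedding.isCompact_iff, image_univ]
    exact hc
  have hE : IsCompact (univ : Set (𝔼 2)) := by
    have himg : Prod.snd '' (univ : Set ((𝕊 1) × 𝔼 2)) = univ :=
      eq_univ_of_forall fun w => ⟨(circlePoint 0, w), mem_univ _, rfl⟩
    have := hc'.image continuous_snd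
    rwa [himg] at this
  exact noncompact_univ (𝔼 2) hE

/-- **Uniqueness of tubular neighbourhoods of a link in `S³`, up to rotation of the fibres.**
Let `νᵢ`, `ν'ᵢ` be oriented tubular neighbourhoods of the components of a link `L` (finitely many
components), each family with pairwise disjoint images. Then there are a diffeomorphism `φ` of `S³`
fixing every component of `L` pointwise and a radius `r > 0` such that
`φ (νᵢ (x, w)) = ν'ᵢ (x, w₀ uᵢ(x) + w₁ J uᵢ(x))` for `‖w‖ < r`, where `uᵢ = knotFrameUnit νᵢ ν'ᵢ`
is the (smooth) rotation field of the pair and `J` the quarter turn: on the tube of radius `r`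
about each component, `φ ∘ νᵢ` is `ν'ᵢ` up to the rotation of the fibre over `x` taking `e₀` to
`uᵢ x`. Hirsch, *Differential Topology* (1976), Ch. 4 §5 Thm. 5.3 with Ch. 8 §1 Thm. 1.3;
Kosinski (1993), III.(3.5); the orientation convention `det_pos` excludes reflections of the
fibre (`knotFrameSign_pos`). [cite: Hirsch1976, Ch. 4 §5 Thm. 5.3] -/
theorem exists_diffeomorph_tubularNbhd (L : Link ι) (ν ν' : ∀ i, Knot.TubularNbhd (L.component i))
    (hdisj : Pairwise fun i j ↦ Disjoint (range (ν i)) (range (ν j)))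
    (hdisj' : Pairwise fun i j ↦ Disjoint (range (ν' i)) (range (ν' j))) :
    ∃ φ : (𝕊 3) ≃ₘ⟮𝓡 3, 𝓡 3⟯ (𝕊 3), (∀ i x, φ (L.component i x) = L.component i x) ∧
      ∃ r : ℝ, 0 < r ∧ ∀ i (x : 𝕊 1) (w : 𝔼 2), ‖w‖ < r →
        φ (ν i (x, w)) = ν' i (x, w 0 • (knotFrameUnit (ν i) (ν' i) x : 𝔼 2) +
          w 1 • quarterTurn (knotFrameUnit (ν i) (ν' i) x : 𝔼 2)) := by
  classical
  -- a stereographic chart missing a point off all the `range (ν' i)`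
  obtain ⟨pt, hpt⟩ := exists_not_mem_range L ν' hdisj'
  set σ : OpenPartialHomeomorph (𝕊 3) (𝔼 3) := stereoChart pt with hσ
  have hσsrc : σ.source = {pt}ᶜ := stereoChart_source pt
  have hσtgt : σ.target = univ := stereoChart_target pt
  have hσsm : ContMDiffOn (𝓡 3) (𝓡 3) ∞ σ σ.source := contMDiffOn_stereoChart pt
  have hσsymm : ContMDiff (𝓡 3) (𝓡 3) ∞ σ.symm := contMDiff_stereoChart_symm pt
  have hν₂src : ∀ i q, ν' i q ∈ σ.source := fun i q => by
    rw [hσsrc]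
    exact fun h => hpt i ⟨q, h⟩
  have hν₁src : ∀ i, ∀ q ∈ knotTransitionDom (ν i) (ν' i), ν i q ∈ σ.source := fun i q hq => by
    obtain ⟨q', hq'⟩ := hq
    rw [← hq']
    exact hν₂src i q'
  have hdom_nhds : ∀ i (x : 𝕊 1),
      knotTransitionDom (ν i) (ν' i) ∈ 𝓝 ((x, (0 : 𝔼 2)) : (𝕊 1) × 𝔼 2) := fun i x =>
    (isOpen_knotTransitionDom (ν i) (ν' i)).mem_nhds (mem_knotTransitionDom_zero (ν i) (ν' i) x)
  -- the maps, component by component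
  set g : ∀ i, (𝕊 1) → (𝔼 2 ≃ₗᵢ[ℝ] 𝔼 2) := fun i => knotFrame (ν i) (ν' i) with hg
  have hgsmooth : ∀ i, ContMDiff I𝕋₁ 𝓘(ℝ, 𝔼 2) ∞ (fun p : (𝕊 1) × 𝔼 2 => g i p.1 p.2) := fun i =>
    contMDiff_knotFrame (ν i) (ν' i)
  set Qm : ∀ i, (𝕊 1) × 𝔼 2 → (𝕊 1) × 𝔼 2 := fun i => circleFibrewiseMap (g i) with hQm
  have hQmsm : ∀ i, ContMDiff I𝕋₁ I𝕋₁ ∞ (Qm i) := fun i => contMDiff_circleFibrewiseMap (hgsmooth i)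
  set e₁ : ∀ i, (𝕊 1) × 𝔼 2 → 𝔼 3 := fun i q => σ (ν i q) with he₁
  set e₂ : ∀ i, (𝕊 1) × 𝔼 2 → 𝔼 3 := fun i q => σ (ν' i q) with he₂
  set Pc : ι → 𝔼 3 → 𝔼 3 := fun i y => σ (ν' i (Qm i ((ν i).toHomeo.symm (σ.symm y)))) with hPc
  set W : ι → Set (𝔼 3) := fun i => σ '' (ν i '' knotTransitionDom (ν i) (ν' i)) with hW
  set Z : ι → Set (𝔼 3) := fun i => range fun x : 𝕊 1 => e₁ i (x, 0) with hZ
  -- smoothness of `e₁`, `e₂`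
  have he₁sm : ∀ i, ∀ q ∈ knotTransitionDom (ν i) (ν' i), ContMDiffAt I𝕋₁ (𝓡 3) ∞ (e₁ i) q :=
    fun i q hq => (hσsm.contMDiffAt (σ.open_source.mem_nhds (hν₁src i q hq))).comp q
      ((ν i).contMDiffAt_coe q)
  have he₂sm : ∀ i q, ContMDiffAt I𝕋₁ (𝓡 3) ∞ (e₂ i) q := fun i q =>
    (hσsm.contMDiffAt (σ.open_source.mem_nhds (hν₂src i q))).comp q ((ν' i).contMDiffAt_coe q)
  -- `W i` open, pairwise disjoint; `Z i` compact, inside `W i`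
  have hWopen : ∀ i, IsOpen (W i) := fun i => by
    apply σ.isOpen_image_of_subset_source ((ν i).isOpenMap _ (isOpen_knotTransitionDom (ν i) (ν' i)))
    rintro _ ⟨q, hq, rfl⟩
    exact hν₁src i q hq
  have hWdisj : ∀ {i j} (y : 𝔼 3), y ∈ W i → y ∈ W j → i = j := by
    rintro i j _ ⟨_, ⟨q, hq, rfl⟩, rfl⟩ ⟨_, ⟨q', hq', rfl⟩, hyy⟩
    have h1 : ν j q' = ν i q := σ.injOn (hν₁src j q' hq') (hν₁src i q hq) hyy
    by_contra hij
    exact Set.disjoint_left.1 (hdisj (Ne.symm hij)) (mem_range_self q') (h1 ▸ mem_range_self q)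
  have hZcpt : ∀ i, IsCompact (Z i) := fun i => by
    apply isCompact_range
    show Continuous (e₁ i ∘ fun x : 𝕊 1 => ((x, (0 : 𝔼 2)) : (𝕊 1) × 𝔼 2))
    have hon : ContinuousOn (e₁ i) (knotTransitionDom (ν i) (ν' i)) := fun q hq =>
      (he₁sm i q hq).continuousAt.continuousWithinAt
    exact hon.comp_continuous (continuous_id.prodMk continuous_const)
      fun x => mem_knotTransitionDom_zero (ν i) (ν' i) x
  have hZW : ∀ i, Z i ⊆ W i := by
    rintro i _ ⟨x, rfl⟩
    exact ⟨ν i (x, 0), ⟨(x, 0), mem_knotTransitionDom_zero (ν i) (ν' i) x, rfl⟩, rfl⟩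
  -- the global map `P`
  set P : 𝔼 3 → 𝔼 3 := fun y => if h : ∃ i, y ∈ W i then Pc (Classical.choose h) y else y with hP
  have hPW : ∀ i, ∀ y ∈ W i, P y = Pc i y := fun i y hy => by
    have h : ∃ j, y ∈ W j := ⟨i, hy⟩
    have hP' : P y = Pc (Classical.choose h) y := by simp only [hP, dif_pos h]
    rw [hP', hWdisj y (Classical.choose_spec h) hy]
  have hPnot : ∀ y, (∀ i, y ∉ W i) → P y = y := fun y hy => by
    have h : ¬ ∃ j, y ∈ W j := fun ⟨j, hj⟩ => hy j hj
    simp only [hP, dif_neg h]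
  -- `Pc i` is smooth on `W i`
  have hPcsm : ∀ i, ContDiffOn ℝ ∞ (Pc i) (W i) := fun i => by
    rw [← contMDiffOn_iff_contDiffOn]
    rintro _ ⟨_, ⟨q, hq, rfl⟩, rfl⟩
    apply ContMDiffAt.contMDiffWithinAt
    have h1 : ContMDiffAt (𝓡 3) (𝓡 3) ∞ σ.symm (σ (ν i q)) := hσsymm _
    have h2 : ContMDiffAt (𝓡 3) I𝕋₁ ∞ (ν i).toHomeo.symm (σ.symm (σ (ν i q))) := by
      rw [σ.left_inv (hν₁src i q hq)]
      exact (ν i).contMDiffAt_toHomeo_symm ⟨q, rfl⟩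
    have h21 : ContMDiffAt (𝓡 3) I𝕋₁ ∞ ((ν i).toHomeo.symm ∘ σ.symm) (σ (ν i q)) := h2.comp _ h1
    have h3 : ContMDiffAt I𝕋₁ (𝓡 3) ∞ (fun p => σ (ν' i (Qm i p)))
        (((ν i).toHomeo.symm ∘ σ.symm) (σ (ν i q))) := (he₂sm i _).comp _ (hQmsm i _)
    exact ContMDiffAt.comp (σ (ν i q)) (g := fun p => σ (ν' i (Qm i p))) h3 h21
  -- `P` is smooth on `W = ⋃ W i`
  have hPsm : ContDiffOn ℝ ∞ P (⋃ i, W i) := by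
    intro y hy
    obtain ⟨i, hyi⟩ := mem_iUnion.1 hy
    have hev : P =ᶠ[𝓝 y] Pc i :=
      Filter.eventuallyEq_of_mem ((hWopen i).mem_nhds hyi) fun y' hy' => hPW i y' hy'
    exact (((hPcsm i).contDiffAt ((hWopen i).mem_nhds hyi)).congr_of_eventuallyEq hev).contDiffWithinAt
  -- `P ∘ e₁ = e₂ ∘ Qm` on the domains
  have hPe₁ : ∀ i, ∀ q ∈ knotTransitionDom (ν i) (ν' i), P (e₁ i q) = e₂ i (Qm i q) := fun i q hq => by
    have hyW : e₁ i q ∈ W i := ⟨ν i q, ⟨q, hq, rfl⟩, rfl⟩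
    rw [hPW i _ hyW]
    simp only [hPc, he₁, he₂]
    rw [σ.left_inv (hν₁src i q hq), (ν i).toHomeo_symm_apply]
  have hPZ : ∀ z ∈ ⋃ i, Z i, P z = z := by
    intro z hz
    obtain ⟨i, x, rfl⟩ : ∃ (i : ι) (x : 𝕊 1), e₁ i (x, 0) = z := by
      simpa only [mem_iUnion, hZ, mem_range] using hz
    rw [hPe₁ i _ (mem_knotTransitionDom_zero (ν i) (ν' i) x)]
    simp only [he₁, he₂, hQm, circleFibrewiseMap_zero, (ν i).coe_apply_zero, (ν' i).coe_apply_zero]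
  have hWopen' : IsOpen (⋃ i, W i) := isOpen_iUnion hWopen
  have hZcpt' : IsCompact (⋃ i, Z i) := isCompact_iUnion hZcpt
  have hZW' : (⋃ i, Z i) ⊆ ⋃ i, W i := iUnion_mono hZW
  have hPderiv : ∀ z ∈ ⋃ i, Z i, HasFDerivAt P (fderiv ℝ P z) z := fun z hz =>
    ((hPsm.contDiffAt (hWopen'.mem_nhds (hZW' hz))).differentiableAt (by simp)).hasFDerivAt
  -- **the derivative of the straight-line isotopy is injective along the link**
  have hinj : ∀ z ∈ ⋃ i, Z i, ∀ t ∈ Icc (0 : ℝ) 1, Injective (slDeriv t (fderiv ℝ P z)) := by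
    intro z hz t ht
    obtain ⟨i, x, rfl⟩ : ∃ (i : ι) (x : 𝕊 1), e₁ i (x, 0) = z := by
      simpa only [mem_iUnion, hZ, mem_range] using hz
    have hPd : ∀ x' : 𝕊 1, DifferentiableAt ℝ (Pc i) (e₁ i (x', 0)) := fun x' =>
      ((hPcsm i).contDiffAt ((hWopen i).mem_nhds (hZW i ⟨x', rfl⟩))).differentiableAt (by simp)
    have hPce₁ : ∀ q ∈ knotTransitionDom (ν i) (ν' i), Pc i (e₁ i q) = e₂ i (Qm i q) :=
      fun q hq => by rw [← hPW i _ ⟨ν i q, ⟨q, hq, rfl⟩, rfl⟩]; exact hPe₁ i q hq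
    have key := injective_slDeriv_component (pt := pt) (ν i) (ν' i) (hν₂src i) hPce₁ hPd x ht
    have hfd : fderiv ℝ P (e₁ i (x, 0)) = fderiv ℝ (Pc i) (e₁ i (x, 0)) := by
      apply Filter.EventuallyEq.fderiv_eq
      exact Filter.eventuallyEq_of_mem ((hWopen i).mem_nhds (hZW i ⟨x, rfl⟩))
        fun y' hy' => hPW i y' hy'
    rw [hfd]
    exact key
  -- **the isotopy extension theorem** in the chart, and transport back to `S³`
  obtain ⟨Φ, hΦP, R, hΦR⟩ := exists_diffeomorph_eqOn_nhdsSet_of_straightLine hZcpt' hWopen' hZW'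
    hPsm hPZ hPderiv hinj
  obtain ⟨H, hH, -⟩ := exists_diffeomorph_chartTransport (φ := σ) hσsm hσsymm hσtgt Φ hΦR
  -- the neighbourhood of the link where `Φ = P`
  obtain ⟨U, hUopen, hZU, hUP⟩ : ∃ U : Set (𝔼 3), IsOpen U ∧ (⋃ i, Z i) ⊆ U ∧ ∀ y ∈ U, Φ y = P y := by
    obtain ⟨U, hUo, hZU', hUsub⟩ := mem_nhdsSet_iff_exists.1 hΦP
    exact ⟨U, hUo, hZU', fun y hy => hUsub hy⟩
  have hHν : ∀ i, ∀ q ∈ knotTransitionDom (ν i) (ν' i), e₁ i q ∈ U →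
      H (ν i q) = ν' i (Qm i q) := by
    intro i q hq hqU
    have h1 : ν i q = σ.symm (e₁ i q) := (σ.left_inv (hν₁src i q hq)).symm
    rw [h1, hH, hUP _ hqU, hPe₁ i q hq]
    exact σ.left_inv (hν₂src i _)
  refine ⟨H, fun i x => ?_, ?_⟩
  · -- `H` fixes the link
    have h := hHν i (x, 0) (mem_knotTransitionDom_zero (ν i) (ν' i) x)
      (hZU (mem_iUnion.2 ⟨i, x, rfl⟩))
    simp only [hQm, circleFibrewiseMap_zero, (ν i).coe_apply_zero, (ν' i).coe_apply_zero] at h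
    exact h
  · -- uniform tubes `𝕊 1 × B_r` inside the good sets (tube lemma, component by component)
    have hrad : ∀ i, ∀ᶠ r in 𝓝[>] (0 : ℝ), ∀ (x : 𝕊 1) (w : 𝔼 2), ‖w‖ < r →
        H (ν i (x, w)) = ν' i (Qm i (x, w)) := by
      intro i
      set V : Set ((𝕊 1) × 𝔼 2) := knotTransitionDom (ν i) (ν' i) ∩ e₁ i ⁻¹' U with hV
      have hVopen : IsOpen V := by
        rw [isOpen_iff_mem_nhds]
        rintro q ⟨hq, hqU⟩
        refine Filter.inter_mem ((isOpen_knotTransitionDom (ν i) (ν' i)).mem_nhds hq) ?_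
        exact (he₁sm i q hq).continuousAt.preimage_mem_nhds (hUopen.mem_nhds hqU)
      have hsub : (univ : Set (𝕊 1)) ×ˢ ({0} : Set (𝔼 2)) ⊆ V := by
        rintro ⟨x, w⟩ ⟨-, hw⟩
        rw [mem_singleton_iff] at hw
        subst hw
        exact ⟨mem_knotTransitionDom_zero (ν i) (ν' i) x, hZU (mem_iUnion.2 ⟨i, x, rfl⟩)⟩
      obtain ⟨u₀, v₀, -, hv₀, hu₀, h0v₀, huv⟩ :=
        generalized_tube_lemma isCompact_univ isCompact_singleton hVopen hsub
      obtain ⟨r₀, hr₀, hrv⟩ := Metric.isOpen_iff.1 hv₀ 0 (h0v₀ rfl)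
      filter_upwards [Ioo_mem_nhdsGT hr₀] with r hr x w hw
      have hq : ((x, w) : (𝕊 1) × 𝔼 2) ∈ V :=
        huv ⟨hu₀ (mem_univ x), hrv (mem_ball_zero_iff.2 (hw.trans hr.2))⟩
      exact hHν i (x, w) hq.1 hq.2
    have hall : ∀ᶠ r in 𝓝[>] (0 : ℝ), 0 < r ∧ ∀ i (x : 𝕊 1) (w : 𝔼 2), ‖w‖ < r →
        H (ν i (x, w)) = ν' i (Qm i (x, w)) :=
      (eventually_mem_nhdsWithin).and (Filter.eventually_all.2 hrad)
    obtain ⟨r, hr, hrH⟩ := hall.exists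
    refine ⟨r, hr, fun i x w hw => ?_⟩
    rw [hrH i x w hw]
    simp only [hQm, hg, circleFibrewiseMap_apply, knotFrame_apply, coe_knotFrameUnit]

/-- **Uniqueness of tubular neighbourhoods of a link in `S³`, up to rotation of the fibres**
(rotation-field form): as `exists_diffeomorph_tubularNbhd`, with the rotation fields
`uᵢ : S¹ → S¹` existentially quantified together with their smoothness.
[cite: Hirsch1976, Ch. 4 §5 Thm. 5.3] -/
theorem exists_diffeomorph_tubularNbhd' (L : Link ι) (ν ν' : ∀ i, Knot.TubularNbhd (L.component i))
    (hdisj : Pairwise fun i j ↦ Disjoint (range (ν i)) (range (ν j)))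
    (hdisj' : Pairwise fun i j ↦ Disjoint (range (ν' i)) (range (ν' j))) :
    ∃ φ : (𝕊 3) ≃ₘ⟮𝓡 3, 𝓡 3⟯ (𝕊 3), (∀ i x, φ (L.component i x) = L.component i x) ∧
      ∃ u : ι → (𝕊 1) → 𝕊 1, (∀ i, ContMDiff (𝓡 1) (𝓡 1) ∞ (u i)) ∧
      ∃ r : ℝ, 0 < r ∧ ∀ i (x : 𝕊 1) (w : 𝔼 2), ‖w‖ < r →
        φ (ν i (x, w)) = ν' i (x, w 0 • (u i x : 𝔼 2) + w 1 • quarterTurn (u i x : 𝔼 2)) := by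
  obtain ⟨φ, hφ, r, hr, hφν⟩ := exists_diffeomorph_tubularNbhd L ν ν' hdisj hdisj'
  exact ⟨φ, hφ, fun i => knotFrameUnit (ν i) (ν' i), fun i => contMDiff_knotFrameUnit (ν i) (ν' i),
    r, hr, hφν⟩

end Link

end Literature.Topology.FourManifolds
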